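import Summits.QuantumFields.QCD.Theses.SpectralDefectExtinction
import Summits.QuantumFields.QCD.Theorems.SpectralDefectExtinctionExtinctionBuildsQCDStubSignTransfer
import Summits.QuantumFields.QCD.Theorems.SpectralDefectExtinctionExtinctionBuildsQCDStubSignCocycleLocal
import Summits.QuantumFields.QCD.Theorems.SpectralDefectExtinctionExtinctionBuildsQCDStubTiltLever
import Summits.QuantumFields.QCD.Theorems.SpectralDefectExtinctionExtinctionBuildsQCDStubRateDiverges
import Summits.QuantumFields.QCD.Theorems.SpectralDefectExtinctionExtinctionBuildsQCDStubTiltedCellAverage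
import Summits.QuantumFields.QCD.Theorems.SpectralDefectExtinctionExtinctionBuildsQCDStubFermiProjectorScreeningMassPin
import Summits.QuantumFields.QCD.Theorems.SpectralDefectExtinctionWegnerEstimateStubCellAverageBound
import Literature.Barriers.QuantumFields.WilsonDeterminantSign
import Literature.MathematicalPhysics.QuantumFieldTheory.QCDPhaseQuenched
import Literature.MathematicalPhysics.QuantumLattice.OverlapLocality
import Mathlib.Analysis.Matrix.HermitianFunctionalCalculus
import Mathlib.Data.Real.Sign

/-!
# Line `determinant-tilt` (slug `Sketch_determinant_tilt`, card `determinant-tilt-kinematic-sign`) — crux proof skeleton v9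
# (lead a2 v1–v7, prover-line-stmt-QuantumFields-18064-a2-0; lead c6 v8–, prover-line-stmt-QuantumFields-18064-c6-0; 2026-08-17)

v2 (cycle 1, after wave 1): the two abstract levers are LANDED and IMPORTED — L `stub_tiltLever` (p165340,
`Theorems/…StubTiltLever.lean`) and R `stub_rateDiverges` (p165632, `Theorems/…StubRateDiverges.lean`) —, and K is RESHAPED
along the K-worker's stage-by-stage audit (`work/stubs/stub_kinematicScreening_notes.md`, a2 c1): its deterministic off-window
half is the new PROVABLE-NOW stub S1 `stub_kinematicSignSplit`, and its ONLY probabilistic input is the new registered stub A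
`stub_conditionalSmallBall` (a LOCAL, TILTED Wegner-type small-ball bound at energy 0 under `⟨·⟩₊`, conditional on the exterior in
DLR-tested form — the weakest form K consumes; nearest tree source: the open small-ball stub of crux WegnerEstimate stmt-8966);
K now takes L, S1 and A by name and keeps the deterministic cluster-resolved localisation W3⁺ + the multi-cluster Feshbach
resonance lemma + assembly. Registered stubs (7): P, S1, A, K, G, S, C.

v3 (cycle 1, after wave 2): S1 `stub_kinematicSignSplit` LANDED (p167777) and IMPORTED; A RESHAPED along the A-worker's audit
(`work/stubs/stub_conditionalSmallBall_notes.md`): exterior threshold `r + R₀`, Hölder exponent `(τ/w)^α`, and the new PROVABLE-NOW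
transport stub T `stub_tiltedCellAverage` taken by name, so that A's residual is BY NAME the local Haar–Wegner lemma of crux
WegnerEstimate stmt-8966 (Hölder branch) on the mass range `[−1,1]`. Registered stubs (7): P, T, A, K, G, S, C; landed L, R, S1.

v4 (cycle 1, after wave 3): T `stub_tiltedCellAverage` LANDED (p169328) and IMPORTED; new PROVABLE-NOW stub Q `stub_quasimodeResolventTrace`
(quasi-mode ⇒ resolvent trace on the support) taken by A by name, so that A = T ∘ Q ∘ [8966 local Haar–Wegner, Hölder, masses in
`[−1,1]`] + bookkeeping. Registered stubs (7): P, Q, A, K, G, S, C; landed this session L, R, S1, T.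

v5 (cycle 1, same wave): A's research residual is REGISTERED as its own stub W `stub_localHaarWegnerWide` (8966's local Haar–Wegner
lemma, Hölder form, large tori, masses in `[−1,1]` — OPEN, 8966's bet, shared-item recommendation), and A becomes PROVABLE NOW:
A : T → W → (SD⁺ prefix) → body, with Q proved inside A's file (bookkeeping: Q pointwise, T per cell centre in the ball, CAP for
`|ball|`, asymptotic scaling for `(1+β_k)^p`, the landed mass pin). Registered stubs (7): P, W, A, K, G, S, C; landed L, R, S1, T.

v6 (cycle 1, after wave 4): A LANDED (p170870 + Aux p170546) and IMPORTED; new ABSTRACT provable-now stub K2 `stub_gappedSignPerturbation`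
(`‖sgn A − sgn B‖_F ≤ ‖A−B‖_F/g` for Hermitian matrices gapped at 0) taken by K. Registered stubs (7): P, W, K2, K, G, S, C; landed this
session L, R, S1, T, A.

v7 (end of cycle 1, after wave 5): K2 LANDED (p171070) and IMPORTED. Registered OPEN stubs (6): P (class clause), W (8966 variant), K, G, S, C;
landed this session: L p165340, R p165632, S1 p167777, T p169328, A p170870 (+Aux p170546), K2 p171070. NOTE for K's prover: S1's window
term carries absolute values (eigenfunction correlator) and is LOSSY for same-sign hybridised wells; the optimal proof of K keeps the sign
structure (`sgn·(1 − |p_D|)` on the window, smooth weight, K2-type Frobenius perturbation for the smooth part, A only ACROSS zero).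

v8 (lead c6, cycle 2 of the line): K `stub_kinematicScreening` RESHAPED through weyl-window's LANDED Aizenman–Graf reduction into
K_AG `stub_signScreeningOfBand` (provable now: fractional moments in mean ⇒ sign matrix in mean, k-dependent rate, polynomial constant)
∘ K_FM `stub_kinematicBandScreening` (OPEN research residual = weyl-window's Stub 2 re-typed kinematically: Aizenman–Molchanov fractional
moments of `(Γ₅D_W − iη)⁻¹` in ⟨·⟩₊-mean at rate `κ w_f(k)`, constant `(Z_k/a_k)^p`; single-scale ASFH criterion; named gaps: Dirichlet
vs full-operator small ball, rarity-vs-polynomial-loss budget) fed the new provable-now stub R2 `stub_localRarityOfExtinct` (local rarity of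
bad balls from EXTINCT by translation averaging + the well budget; unconditional) and A. Registered OPEN stubs (8 sorried + 4 landed
placeholders while the farm is stale): P, W, R2, K_FM, K_AG, G, S, C. G's hypothesis (K's conclusion) is byte-identical to v7.

v9 (lead c6, cycle 2, after wave 1): K_AG `stub_signScreeningOfBand` LANDED (p173045) and R2 `stub_localRarityOfExtinct` LANDED (p173605)
(placeholders while the farm builds them; T now imported); K_FM's design fixed to the LEAST-SQUARES local inverse (closes v8's gap (1)) and
three ABSTRACT provable-now FMM lemmas registered and consumed by K_FM by name: D2′ `stub_leastSquaresCombesThomas` (CT for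
`(P Aᴴ A P + 1 − P)⁻¹` at the rate of the coercivity LEVEL), D3 `stub_subharmonicDecay` (subharmonicity ⇒ exponential decay), D4
`stub_smallBallLayerCake` (Hölder small ball ⇒ fractional moment). K_FM's remaining named gaps: (2) rarity-vs-polynomial-loss budget
(needs POLYGROWTH exponent q ≳ 2; EXTINCT heuristically caps q — a class question), (3) two-cell decoupling (8966 currency).
Registered OPEN stubs: P, W, D2′, D3, D4, K_FM, G, S, C (+ placeholders A, R2, K_AG).

Crux stmt-QuantumFields-18064 `Summit.QuantumFields.QCD.Theses.SpectralDefectExtinction.ExtinctionBuildsQCD`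
(`∀ N_f ∈ {2,3}, SD⁺(N_f) → THR(N_f)`).

ARCHITECTURE (the card's §"Dead lines" composition, = weyl-window's kernel-checked `ExtinctionBuildsQCD_of` retargeted from
`QCDOf` to the threshold body THR — no threshold shift needed, `M₁ := M₀`, `reg' := reg ∘ φ` — with the SIGN MODULE re-typed
KINEMATICALLY):

  `ExtinctionBuildsQCD_of = compose ∘ ⟨P, C, S, G(K_AG(K_FM(D2′, D3, D4, R2, A(T, W))), R, coc)⟩`   (v9; L, S1, K2 landed, importable)

* L  `stub_tiltLever`                 — ABSTRACT LEVER, LANDED p165340 (imported): the determinant tilt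
                                         `(∫_{|x|<τ}|x|ⁿdν)·θⁿν{θ≤|x|} ≤ τⁿν{|x|<τ}·∫_{θ≤|x|}|x|ⁿdν` for EVERY measure `ν`
                                         (card Lever (1)) AND the finite log-moment it buys,
                                         `∫_{|x|<θ} |x|ⁿ log⁴(θ/|x|) dν ≤ (4/(ne))⁴ θⁿ ν{|x|<θ}` (`n ≥ 1`);
* R  `stub_rateDiverges`              — ABSTRACT LEVER, LANDED p165632 (imported): rarity beats reach,
                                         `(m/Z_k)(ℓog_k − log Z_k − K) → ∞` when `Z_k ≤ C x_k^γ`, `γ < 1`, `q x_k ≤ ℓog_k`;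
* S1 `stub_kinematicSignSplit`        — DETERMINISTIC, LANDED p167777 (v2 → imported v3): for every `SU(3)` field, `|m₀| ≤ 1`, level `t ∈ (0,1]`:
                                         `Σ_{p,q}‖sgn(Γ₅D_W(U,m₀,1))((x,p),(y,q))‖ ≤ (C₁/t) e^{−c₁ t |x−y|₁} + 2 Σ_{p,q} Σ_{|λ_i|<t}
                                         ‖u_i(x,p)‖‖u_i(y,q)‖` — the sign matrix is a kinematically local part plus a window-mode
                                         part (Chebyshev needle `stub_signPolyApprox` p97539 + range one + spectrum in `[−9,9]`; no
                                         Combes–Thomas, no fractional moments);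
* T  `stub_tiltedCellAverage`         — LANDED p169328 (v3 → imported v4): tested, tilted cell average `⟨F·g⟩₊ ≤ C(1+β^p)·M·⟨F⟩₊` for cell-fibre
                                         Haar means `≤ M` and cell-exterior `F ∈ [0,1]` (PQ analogue of 8966's `stub_cellAverageBound`);
* W  `stub_localHaarWegnerWide`       — OPEN = crux 8966's local Haar–Wegner lemma (Hölder, large tori) with masses in `[−1,1]`
                                         (v5; blocked-on stmt-QuantumFields-8966 + mass-range extension; shared-item recommendation);
* A  `stub_conditionalSmallBall`      — OPEN (L), THE ONLY PROBABILISTIC INPUT OF THE SIGN MODULE (v2; v3: threshold `r+R₀`,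
                                         exponent `α`, takes T; v5: takes W) — LANDED p170870 (v6: imported):
                                         for SD⁺-witness data, eventually in `k`, on all tori `S ≥ L_k`, for every flavour, box
                                         `(x₀, r ≤ L_k)`, level `0 < τ ≤ θ w_f(k)` (`w_f(k) = c a_k m_f/Z_k`) and every
                                         exterior-local test functional `F ∈ [0,1]`:
                                         `⟨F·1{box bad at level τ}⟩₊ ≤ C (Z_k/a_k)^p (τ/w_f(k)) ⟨F⟩₊` — a LOCAL (frozen exterior,
                                         DLR-tested), TILTED (`∏|det|`-weighted) Wegner-type small-ball bound, linear in the level,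
                                         AT ENERGY 0 ONLY (the sign function's only singularity, where the `|λ|^{n_f}` tilt acts);
                                         nearest tree source: the open Haar small-ball stub of crux WegnerEstimate stmt-8966;
* P  `stub_polyGrowthWitness`         — CLASS CLAUSE (∃-form transfer): an SD⁺(N_f) witness may be taken POLYGROWTH,
                                         `∃ q > 0, ∀ᶠ k, a_k^{-q} ≤ a_k L_k`.  NOT a lemma: SD⁺ as filed does not see the growth
                                         of the physical volume (Disproof §8b/§10a, `Negative/VolumeFloor` p149644 for GROWTH;
                                         heuristically honest bounded-physical-volume members of SD⁺ exist), so in truth value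
                                         this stub is the sibling hinge stmt-18063 RESTATED with POLYGROWTH (given SD⁺ inhabited)
                                         and becomes `fun _ _ h => h`-trivial after the restate recommended by TRIAGE-r1-3 O1 /
                                         Disproof §10c(1) / the card (certified harmless: `canonicalAF` meets POLYGROWTH with
                                         `q = 1`, sketch `canonicalAF_polyGrowth`, so TIGHT⁺ stays the only junk-excluder).
                                         Declared here, flagged to the planners, never hidden in another stub;
* K2 `stub_gappedSignPerturbation`    — ABSTRACT, LANDED p171070 (v6 → imported v7): `‖sgn A − sgn B‖_F ≤ ‖A − B‖_F/g` for Hermitian `A, B`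
                                         gapped at `0` (Sylvester-equation proof, no integrals) — K's matrix-level resonance lemma;
* K  = K_AG ∘ K_FM (v8; v2–v7 `stub_kinematicScreening`): KINEMATIC Fermi-projector screening in `⟨·⟩₊`-mean
                                         (`E₊ Σ‖sgn(Γ₅D_W(m_f(k)))(x,·;y,·)‖ ≤ C (Z_k/a_k)^p e^{−κ (c a_k m_f/Z_k) |x−y|₁}` on all tori
                                         `S ≥ L_k`), replacing weyl-window Stub 2 (PHYSICAL rate, "stub-blocked: none in tree"):
  * R2   `stub_localRarityOfExtinct`   — LANDED p173605 (v8 → v9): local rarity of bad balls, `⟨1_{B(x₀,r) bad at level τ ≤ w_f}⟩₊ ≤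
                                         ε(4r+5)⁴/(2L_k+1)⁴` from EXTINCT by translation averaging + the well budget (unconditional);
  * K_FM `stub_kinematicBandScreening` — OPEN (L–XL, v8): Aizenman–Molchanov fractional moments of `(Γ₅D_W(m_f(k)) − iη)⁻¹`,
                                         `η ∈ (0,1]`, in `⟨·⟩₊`-mean at the kinematic rate with a polynomial constant, FROM R2 and A
                                         (single-scale ASFH criterion; named gaps: Dirichlet-vs-full small ball, rarity budget);
  * K_AG `stub_signScreeningOfBand`    — LANDED p173045 (v8 → v9): band ⇒ sign by the LANDED `WeylWindow.stub_aizenmanGrafInMean` family;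
  * D2′ D3 D4                          — ABSTRACT, PROVABLE NOW (v9): least-squares Combes–Thomas, subharmonic decay, small-ball layer cake;
* G  `stub_signedLatticeGapKinematic` — OPEN (XL): the all-volume signed `HasLatticeMassGap Δ` by a Kotecký–Preiss sign-defect
                                         expansion at KINEMATIC range `R_k = Z_k/(κ c a_k m)` — activities local by the landed
                                         cocycle (p104175) + K, dilute by EXTINCT's first moment + POLYGROWTH, rate by R; named
                                         burdens NOT supplied: joint rarity JR, ratio-mixing of the non-local reference (core), OS
                                         positivity of the honest side (BRANCH);
* S  `stub_signDefectRegularity`      — OPEN: weyl-window 3b verbatim under this prefix (sign-defective part of the honest Berezin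
                                         numerator is `o(∫|det|)` along `φ`); consumed through the LANDED kernel reduction
                                         `WeylWindow.signTransfer_of_signDefectRegularity` (p101988) to give honest − PQ → 0 at
                                         the scheme volume;
* C  `stub_pqCore`                    — DECLARED YM-GRADE (open problem; = weyl-window Stub 4 / the c1–c3 promote dossier): the
                                         positive-weight continuum core of the `∏|det|` theory along ONE `φ` serving all `m > M₀`
                                         (PQ Schwinger convergence + OS data + non-trivial non-Gaussian glue + dynamical quarks +
                                         `HasMassGap`); TIGHT⁺ is spent HERE (extensive two-sided pin ⇒ light, non-decoupled quarks).

Composition `ExtinctionBuildsQCD_of` (sorry-free, uses the stubs BY NAME): P upgrades the witness; C gives `φ` and, per tuple,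
`(z, shift, T, Δ_T)`; G gives `Δ_L`; `IsQCDAlong` along `reg ∘ φ` = asymptotic scaling ∘ φ + BRANCH + (PQ convergence + [honest − PQ →
0 from S via the landed reduction, fed EXTINCT]); `Δ := min Δ_T Δ_L` by antitonicity; `reg' := regSubseq reg φ`, `M₁ := M₀`.

DISPROOF USED (`Cruxes/ExtinctionBuildsQCD/Disproof.lean`, g1–g4, current §10): no `_false_without_` short of `¬THR` (§0′/§7d), no
`-- Targets`; §2/§7a (TIGHT⁺ the only junk-excluding clause) honoured — TIGHT⁺ is threaded (PQ reading) into every `reg`-stub and is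
LOAD-BEARING in C; §6d `c ≤ 1` respected (K/G use the inner scales `θ·c a m/Z`, `c a m/(4Z)`); §8b/§10a GROWTH sharpened to POLYGROWTH
and carried by P ALONE; §9b parity-factorisation currency adopted (G expands the sign; no Markov margin, no fibre positivity).
FARM NOTE: `Negative/{WithoutTightPlusCollapse, ExtensivePin, VolumeGrowth}` are accepted but UNBUILT on the farm (probes 13:5xZ,
`remote:stale:unbuilt`), so the SD⁺/THR vocabulary is spelled out (verbatim route text) rather than imported; `Negative.Extinct` (root
module, built) is used for the landed reduction's hypothesis.
-/

noncomputable section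

namespace Summit.QuantumFields.QCD.Cruxes.ExtinctionBuildsQCD.DeterminantTilt

open scoped BigOperators Topology Classical MeasureTheory Matrix ENNReal SchwartzMap
open Filter MeasureTheory Matrix
open Literature.MathematicalPhysics.QuantumLattice Literature.MathematicalPhysics.QuantumFieldTheory
  Literature.Probability.LatticeModels Literature.MathematicalPhysics.AQFT
open Summit.QuantumFields.QCD.Theses.SpectralDefectExtinction
open Literature.Barriers.QuantumFields.WilsonDeterminant (hermitianWilsonDirac Idx)
open Summit.QuantumFields.QCD.Theorems.ExtinctionBuildsQCD.Negative (Extinct Tight)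
open Summit.QuantumFields.QCD.Cruxes.ExtinctionBuildsQCD.WeylWindow (signTransfer_of_signDefectRegularity
  stub_signCocycleLocal stub_massPinAbsLeOne)

/-! ## §1 The registered stubs

Stubs L `stub_tiltLever` (p165340) and R `stub_rateDiverges` (p165632) are LANDED and IMPORTED (same namespace), and are used by
name in `ExtinctionBuildsQCD_of` below. -/

/-! **Stub S1 `stub_kinematicSignSplit` is LANDED (p167777, `Theorems/…StubKinematicSignSplit.lean`, wave 2)** (v8: no longer threaded
through `ExtinctionBuildsQCD_of` — K_FM's prover imports it; its placeholder is dropped): the sign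
matrix of `Γ₅D_W(U,m₀,1)` splits into a kinematically local part `(C₁/t)e^{−c₁t|x−y|₁}` (`c₁ = 1/16`) and a window-mode part
`2Σ_{|λ_i|<t}‖u_i(x,p)‖‖u_i(y,q)‖`; public re-export `signPolyApprox_bounded` (needle with `|p| ≤ 1` on `[−9,9]`). -/

/-! **Stub T `stub_tiltedCellAverage` is LANDED (p169328, `Theorems/…StubTiltedCellAverage.lean`, wave 3) and IMPORTED (v9: farm built)**: the tested,
tilted cell average `⟨F·g⟩₊ ≤ C(1+β^p)·M·⟨F⟩₊` (cell-fibre Haar means of `g ≤ M`, cell-exterior `F ∈ [0,1]`); reusable exports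
`tilted_fibreDomination` (cell tilted flatness for ANY listed link set, all masses, `β ≥ 0`) and `tilted_abstract` (tested Fubini). -/

/-- **Stub W (`stub_localHaarWegnerWide`) — THE LOCAL HAAR–WEGNER LEMMA OF CRUX WegnerEstimate (stmt-QuantumFields-8966), HÖLDER
FORM, LARGE TORI, MASS RANGE EXTENDED TO `[−1,1]` (OPEN — it is 8966's own bet, NOT this line's to prove; v5).** There are a cell size
`R`, a torus threshold `L₀`, `C > 0` and `θ ∈ [0,1)` such that on every torus of side `L ≥ L₀`, for every site `x`, bare mass
`m₀ ∈ [−1,1]`, `ε ∈ (0,1]` and EVERY gauge field `U` (the frozen genuine exterior): the product-Haar average over the links based in the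
cube `x + box 4 R` of the colour–spin resolvent trace `t_x = Σ_{a,α} Im((Γ₅D_W(·,m₀,1) − iε)⁻¹)_{(x,a,α),(x,a,α)}` is `≤ C ε^{−θ}`.
This is VERBATIM the hypothesis `hloc` of the landed `WegnerEstimate.ResolventCell.wegnerEstimateHolder_of_localHaarWegnerHolder`
(p147521) except for (i) the torus range (`L ≥ L₀` instead of `L ≥ 2`: only large tori are needed here, 8966's `localHaarWegner_large`
regime, where `stub_coareaWegnerFrom (2R+3)` p162933 reduces it to the envelope small ball) and (ii) the MASS RANGE `[−1,1]` instead of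
`[−1,0]` (our flavour masses `m_f(k) = m_crit(k) + a_k m_f/Z_k ∈ (−1,1]`; for `m₀ ∈ (0, ε)` the bad-box event is not empty and no
coercivity helps, so the same Wegner mechanism is asked; the template `(m₀+4)Γ₅ − λ` of 8966's `badStar` stays invertible). STATUS:
OPEN; in 8966's words its Hölder branch is "the weak envelope small ball (any exponent m > 0): classical semialgebraic geometry + one
certified generic-rank computation" (`stub_coareaWegnerHolder` p147831 ∘ weak `stub_envSmallBall`, both conditional today); the linear
branch `θ = 0` is 8966's main bet `stub_envSmallBallLarge`. `blocked-on: stmt-QuantumFields-8966` (Hölder small-ball stub) + the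
mass-range extension, recommended to the planners as ONE shared item. Why it might fail: Wegner's obstruction for unitary link disorder
("links enter unitarily with no spectral-averaging variable", 8966's why-might-fail) at the level of a Hölder local law; 8966's
Disproof v9 (c) tangency shape. [Wegner1981DensityOfStates; Erdős–Hasler AHP 13 (2012); GoltermanShamir2003] -/
theorem stub_localHaarWegnerWide :
    (∃ R L₀ : ℕ, ∃ C θ : ℝ, 0 < C ∧ 0 ≤ θ ∧ θ < 1 ∧ ∀ (L : ℕ) [NeZero L], L₀ ≤ L →
      ∀ (x : TorusSite 4 L) (m₀ ε : ℝ), -1 ≤ m₀ → m₀ ≤ 1 → 0 < ε → ε ≤ 1 →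
      ∀ U : GaugeConfig 4 L SU3,
        ∫ V, (∑ a : Fin 3, ∑ α : Fin 4,
          (((spinorLift gammaFive * wilsonDirac (fundamentalRep (Fin 3))
              (fun e => if (∃ y ∈ box 4 R, e.1 = x + Torus.proj L y) then V e else U e) m₀ 1 -
            ((ε : ℂ) * Complex.I) • (1 : Matrix (QuarkIdx L) (QuarkIdx L) ℂ))⁻¹ :
              Matrix (QuarkIdx L) (QuarkIdx L) ℂ) (x, a, α) (x, a, α)).im)
          ∂(Measure.pi fun _ : Edge 4 L => haarProbability SU3) ≤ C * ε ^ (-θ)) := by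
  sorry

/-- **PLACEHOLDER for the LANDED stub `stub_conditionalSmallBall` (p170870)** — a `sorry` here ONLY because the farm had not yet built the landed module at
registration time (`remote:stale:unbuilt`); the import form (`work/ExtinctionBuildsQCD.lean` of the lead) replaces this file at the
next publication. -/
theorem stub_conditionalSmallBall :
    (∀ (Nf R : ℕ), ∃ C p : ℝ, 0 < C ∧ 0 ≤ p ∧ ∀ β : ℝ, 1 ≤ β → ∀ mq : Fin Nf → ℝ, (∀ g, -2 ≤ mq g ∧ mq g ≤ 2) →
      ∀ (L : ℕ) [NeZero L], max 4 (2 * R + 3) ≤ L →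
      ∀ (x : TorusSite 4 L) (g : GaugeConfig 4 L SU3 → ℝ), Continuous g → (∀ U, 0 ≤ g U) → ∀ M : ℝ,
        (∀ U : GaugeConfig 4 L SU3,
          ∫ V, g (fun e => if (∃ y ∈ box 4 R, e.1 = x + Torus.proj L y) then V e else U e)
            ∂(Measure.pi fun _ : Edge 4 L => haarProbability SU3) ≤ M) →
        ∀ F : GaugeConfig 4 L SU3 → ℝ, Measurable F → (∀ U, 0 ≤ F U ∧ F U ≤ 1) →
          (∀ U V : GaugeConfig 4 L SU3,
            (∀ e : Edge 4 L, ¬ (∃ y ∈ box 4 R, e.1 = x + Torus.proj L y) → U e = V e) → F U = F V) →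
          qcdPhaseQuenchedExpect β L mq (fun U => F U * g U) ≤ C * (1 + β ^ p) * M * qcdPhaseQuenchedExpect β L mq F) →
    (∃ R L₀ : ℕ, ∃ C θ : ℝ, 0 < C ∧ 0 ≤ θ ∧ θ < 1 ∧ ∀ (L : ℕ) [NeZero L], L₀ ≤ L →
      ∀ (x : TorusSite 4 L) (m₀ ε : ℝ), -1 ≤ m₀ → m₀ ≤ 1 → 0 < ε → ε ≤ 1 →
      ∀ U : GaugeConfig 4 L SU3,
        ∫ V, (∑ a : Fin 3, ∑ α : Fin 4,
          (((spinorLift gammaFive * wilsonDirac (fundamentalRep (Fin 3))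
              (fun e => if (∃ y ∈ box 4 R, e.1 = x + Torus.proj L y) then V e else U e) m₀ 1 -
            ((ε : ℂ) * Complex.I) • (1 : Matrix (QuarkIdx L) (QuarkIdx L) ℂ))⁻¹ :
              Matrix (QuarkIdx L) (QuarkIdx L) ℂ) (x, a, α) (x, a, α)).im)
          ∂(Measure.pi fun _ : Edge 4 L => haarProbability SU3) ≤ C * ε ^ (-θ)) →
    ∀ (Nf : ℕ), Nf = 2 ∨ Nf = 3 → ∀ (reg : QCDRegularisation Nf) (M₀ c : ℝ), 0 ≤ M₀ → 0 < c →
      reg.HasMassScaling → (reg.scheme 0 0 0).HasAsymptoticScaling →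
      (∃ p : ℕ, ∀ᶠ k in atTop, (reg.L k : ℝ) ≤ (reg.a k)⁻¹ ^ p) → (∀ᶠ k in atTop, -1 < reg.mcrit k) →
      (∀ m : Fin Nf → ℝ, (∀ f, M₀ < m f) →
        (∀ ε : ℝ, 0 < ε → ∀ᶠ k in atTop, ∀ S : ℕ, reg.L k ≤ S → qcdPhaseQuenchedExpect (reg.β k) (2 * S + 1) (fun f => reg.mcrit k + reg.a k * m f / reg.Zm k) (fun U => ∑ f : Fin Nf, ((Multiset.countP (fun z : ℂ => z.im = 0 ∧ z.re < -(reg.mcrit k + reg.a k * m f / reg.Zm k)) (wilsonDirac (fundamentalRep (Fin 3)) U 0 1).charpoly.roots : ℝ) + (Multiset.countP (fun z : ℂ => |z.re| < c * (reg.a k * m f / reg.Zm k)) (spinorLift gammaFive * wilsonDirac (fundamentalRep (Fin 3)) U (reg.mcrit k + reg.a k * m f / reg.Zm k) 1).charpoly.roots : ℝ))) ≤ ε * ((2 * S + 1 : ℝ) / (2 * reg.L k + 1)) ^ 4) ∧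
        (∃ η : ℝ, 0 < η ∧ ∀ M : ℝ, M₀ < M → ∀ᶠ k in atTop, max 1 (η * (reg.a k * (2 * reg.L k + 1 : ℝ)) ^ 2) ≤ qcdPhaseQuenchedExpect (reg.β k) (2 * reg.L k + 1) (fun f => reg.mcrit k + reg.a k * m f / reg.Zm k) (fun U => |(Multiset.countP (fun z : ℂ => z.re < 0) (spinorLift gammaFive * wilsonDirac (fundamentalRep (Fin 3)) U (reg.mcrit k - reg.a k * M / reg.Zm k) 1).charpoly.roots : ℝ) - 6 * (2 * reg.L k + 1 : ℝ) ^ 4|))) →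
      ∃ R₀ : ℕ, ∃ α : ℝ, 0 < α ∧ α ≤ 1 ∧ ∀ m : Fin Nf → ℝ, (∀ f, M₀ < m f) → ∀ θ : ℝ, 0 < θ → θ < 1 →
        ∃ C p : ℝ, 0 < C ∧ ∀ᶠ k : ℕ in atTop, ∀ S : ℕ, reg.L k ≤ S →
          ∀ (f : Fin Nf) (x₀ : TorusSite 4 (2 * S + 1)) (r : ℕ), r ≤ reg.L k →
          ∀ τ : ℝ, 0 < τ → τ ≤ θ * (c * (reg.a k * m f / reg.Zm k)) →
          ∀ F : GaugeConfig 4 (2 * S + 1) SU3 → ℝ, Measurable F → (∀ U, 0 ≤ F U ∧ F U ≤ 1) →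
            (∀ U V : GaugeConfig 4 (2 * S + 1) SU3,
              (∀ e : TorusSite 4 (2 * S + 1) × Fin 4, r + R₀ < torusTaxiDist e.1 x₀ → U e = V e) → F U = F V) →
            qcdPhaseQuenchedExpect (reg.β k) (2 * S + 1) (fun fl => reg.mcrit k + reg.a k * m fl / reg.Zm k)
                (fun U : GaugeConfig 4 (2 * S + 1) SU3 =>
                  F U * (if (∃ φ : Idx (2 * S + 1) 3 → ℂ, φ ≠ 0 ∧ (∀ p, r < torusTaxiDist p.1 x₀ → φ p = 0) ∧ ∑ p, ‖(hermitianWilsonDirac (fundamentalRep (Fin 3)) U (reg.mcrit k + reg.a k * m f / reg.Zm k) 1 *ᵥ φ) p‖ ^ 2 < τ ^ 2 * ∑ p, ‖φ p‖ ^ 2) then (1 : ℝ) else 0)) ≤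
              C * ((reg.a k)⁻¹ * reg.Zm k) ^ p * (τ / (c * (reg.a k * m f / reg.Zm k))) ^ α *
                qcdPhaseQuenchedExpect (reg.β k) (2 * S + 1) (fun fl => reg.mcrit k + reg.a k * m fl / reg.Zm k) F := by
  sorry

/-! **Stub A `stub_conditionalSmallBall` is LANDED (p170870, `Theorems/…StubConditionalSmallBall.lean`, + helper file
`…StubConditionalSmallBallAux.lean` p170546, wave 4) and IMPORTED**: the transport `T → W → (SD⁺ prefix) → conditional small ball at
energy 0 under ⟨·⟩₊` (threshold `r + 4R`, exponent `α = 1 − θ_W`); public helpers `quasimode_resolvent_trace` (Q), `card_taxiBall_le`,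
`eventually_beta_le`. After it the sign module's ONLY probabilistic input is W. -/

/-! **Stub K2 `stub_gappedSignPerturbation` is LANDED (p171070, `Theorems/…StubGappedSignPerturbation.lean`, wave 5)** (v8: importable by
K_FM's prover, no longer threaded through `ExtinctionBuildsQCD_of`; placeholder dropped):
`‖sgn A − sgn B‖_F ≤ ‖A − B‖_F/g` for Hermitian matrices gapped at `0` (entrywise-in-eigenbases proof; reusable private pattern
`sum_norm_sq_cfc_sub_le`: any entrywise `(f α_i − f β_j)² ≤ c(α_i − β_j)²` gives the Frobenius perturbation bound, e.g. Lipschitz `f`). -/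

/-- **Stub P (`stub_polyGrowthWitness`) — THE CLASS CLAUSE (∃-form transfer; NOT a lemma, see the module docstring).** For
`N_f ∈ {2,3}`: if `SD⁺(N_f)` holds (verbatim the crux hypothesis) then it holds with a witness `(reg, M₀, c)` that is moreover
POLYGROWTH, `∃ q > 0, ∀ᶠ k, a_k^{-q} ≤ a_k L_k` (physical side at least a power of the inverse spacing; inside CAP; met by every
polynomial-volume honest choice `L_k = ⌈a_k^{-1-q}⌉` and by the junk witness `canonicalAF` with `q = 1`). Status: in truth value the
sibling hinge stmt-18063 restated with POLYGROWTH (given SD⁺ inhabited) — `id` after the recommended restate of 18063/18064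
(TRIAGE-r1-3 O1, Disproof §10c(1), card O1); heuristically NOT derivable from SD⁺ as filed (bounded-physical-volume honest members).
Carried openly so that the composition is by name and every other stub states POLYGROWTH as an explicit hypothesis. -/
theorem stub_polyGrowthWitness :
    ∀ (Nf : ℕ), Nf = 2 ∨ Nf = 3 →
      (∃ reg : QCDRegularisation Nf, reg.HasMassScaling ∧ (reg.scheme 0 0 0).HasAsymptoticScaling ∧
        (∃ p : ℕ, ∀ᶠ k : ℕ in Filter.atTop, (reg.L k : ℝ) ≤ (reg.a k)⁻¹ ^ p) ∧ (∀ᶠ k : ℕ in Filter.atTop, -1 < reg.mcrit k) ∧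
        ∃ M₀ : ℝ, 0 ≤ M₀ ∧ ∃ c : ℝ, 0 < c ∧ ∀ m : Fin Nf → ℝ, (∀ f, M₀ < m f) →
          (∀ ε : ℝ, 0 < ε → ∀ᶠ k : ℕ in Filter.atTop, ∀ S : ℕ, reg.L k ≤ S → (∫ U, ((∑ f : Fin Nf, ((Multiset.countP (fun z : ℂ => z.im = 0 ∧ z.re < -(reg.mcrit k + reg.a k * m f / reg.Zm k)) (wilsonDirac (fundamentalRep (Fin 3)) U 0 1).charpoly.roots : ℝ) + (Multiset.countP (fun z : ℂ => |z.re| < c * (reg.a k * m f / reg.Zm k)) (spinorLift gammaFive * wilsonDirac (fundamentalRep (Fin 3)) U (reg.mcrit k + reg.a k * m f / reg.Zm k) 1).charpoly.roots : ℝ)))) * ∏ f : Fin Nf, ‖fermionDet (wilsonDirac (fundamentalRep (Fin 3)) U (reg.mcrit k + reg.a k * m f / reg.Zm k) 1)‖ ∂(wilsonMeasure (d := 4) (L := 2 * S + 1) (fundamentalRep (Fin 3)) (reg.β k))) / (∫ U, ∏ f : Fin Nf, ‖fermionDet (wilsonDirac (fundamentalRep (Fin 3)) U (reg.mcrit k +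 reg.a k * m f / reg.Zm k) 1)‖ ∂(wilsonMeasure (d := 4) (L := 2 * S + 1) (fundamentalRep (Fin 3)) (reg.β k))) ≤ ε * ((2 * S + 1 : ℝ) / (2 * reg.L k + 1)) ^ 4) ∧
          (∃ η : ℝ, 0 < η ∧ ∀ M : ℝ, M₀ < M → ∀ᶠ k : ℕ in Filter.atTop, max 1 (η * (reg.a k * (2 * reg.L k + 1 : ℝ)) ^ 2) ≤ (∫ U, (|(Multiset.countP (fun z : ℂ => z.re < 0) (spinorLift gammaFive * wilsonDirac (fundamentalRep (Fin 3)) U (reg.mcrit k - reg.a k * M / reg.Zm k) 1).charpoly.roots : ℝ) - 6 * (2 * reg.L k + 1 : ℝ) ^ 4|) * ∏ f : Fin Nf, ‖fermionDet (wilsonDirac (fundamentalRep (Fin 3)) U (reg.mcrit k + reg.a k * m f / reg.Zm k) 1)‖ ∂(wilsonMeasure (d := 4) (L := 2 * reg.L k + 1) (fundamentalRep (Fin 3)) (reg.β k))) / (∫ U, ∏ f : Fin Nf, ‖fermionDet (wilsonDirac (fundamentalRep (Fin 3)) U (reg.mcrit k + reg.a k * m f / reg.Zm k) 1)‖ ∂(wilsonMeasure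 (d := 4) (L := 2 * reg.L k + 1) (fundamentalRep (Fin 3)) (reg.β k))))) →
      ∃ (reg : QCDRegularisation Nf) (M₀ c : ℝ), 0 ≤ M₀ ∧ 0 < c ∧
        reg.HasMassScaling ∧ (reg.scheme 0 0 0).HasAsymptoticScaling ∧
        (∃ p : ℕ, ∀ᶠ k in atTop, (reg.L k : ℝ) ≤ (reg.a k)⁻¹ ^ p) ∧ (∀ᶠ k in atTop, -1 < reg.mcrit k) ∧
        (∀ m : Fin Nf → ℝ, (∀ f, M₀ < m f) →
          (∀ ε : ℝ, 0 < ε → ∀ᶠ k : ℕ in Filter.atTop, ∀ S : ℕ, reg.L k ≤ S → (∫ U, ((∑ f : Fin Nf, ((Multiset.countP (fun z : ℂ => z.im = 0 ∧ z.re < -(reg.mcrit k + reg.a k * m f / reg.Zm k)) (wilsonDirac (fundamentalRep (Fin 3)) U 0 1).charpoly.roots : ℝ) + (Multiset.countP (fun z : ℂ => |z.re| < c * (reg.a k * m f / reg.Zm k)) (spinorLift gammaFive * wilsonDirac (fundamentalRep (Fin 3)) U (reg.mcrit k + reg.a k * m f / reg.Zm k) 1).charpoly.roots : ℝ)))) *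 ∏ f : Fin Nf, ‖fermionDet (wilsonDirac (fundamentalRep (Fin 3)) U (reg.mcrit k + reg.a k * m f / reg.Zm k) 1)‖ ∂(wilsonMeasure (d := 4) (L := 2 * S + 1) (fundamentalRep (Fin 3)) (reg.β k))) / (∫ U, ∏ f : Fin Nf, ‖fermionDet (wilsonDirac (fundamentalRep (Fin 3)) U (reg.mcrit k + reg.a k * m f / reg.Zm k) 1)‖ ∂(wilsonMeasure (d := 4) (L := 2 * S + 1) (fundamentalRep (Fin 3)) (reg.β k))) ≤ ε * ((2 * S + 1 : ℝ) / (2 * reg.L k + 1)) ^ 4) ∧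
          (∃ η : ℝ, 0 < η ∧ ∀ M : ℝ, M₀ < M → ∀ᶠ k : ℕ in Filter.atTop, max 1 (η * (reg.a k * (2 * reg.L k + 1 : ℝ)) ^ 2) ≤ (∫ U, (|(Multiset.countP (fun z : ℂ => z.re < 0) (spinorLift gammaFive * wilsonDirac (fundamentalRep (Fin 3)) U (reg.mcrit k - reg.a k * M / reg.Zm k) 1).charpoly.roots : ℝ) - 6 * (2 * reg.L k + 1 : ℝ) ^ 4|) * ∏ f : Fin Nf, ‖fermionDet (wilsonDirac (fundamentalRep (Fin 3)) U (reg.mcrit k + reg.a k * m f / reg.Zm k) 1)‖ ∂(wilsonMeasure (d := 4) (L := 2 * reg.L k + 1) (fundamentalRep (Fin 3)) (reg.β k))) / (∫ U, ∏ f : Fin Nf, ‖fermionDet (wilsonDirac (fundamentalRep (Fin 3)) U (reg.mcrit k + reg.a k * m f / reg.Zm k) 1)‖ ∂(wilsonMeasure (d := 4) (L := 2 * reg.L k + 1) (fundamentalRep (Fin 3)) (reg.β k))))) ∧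
        (∃ q : ℝ, 0 < q ∧ ∀ᶠ k in atTop, (reg.a k)⁻¹ ^ q ≤ reg.a k * (reg.L k : ℝ)) := by
  sorry

/-- **PLACEHOLDER for the LANDED stub `stub_localRarityOfExtinct` (p173605, lead c6 wave 1)** — a `sorry` here ONLY because the farm had not yet built the landed module at registration time (`remote:stale:unbuilt`); replaced by the import at the next publication. The registered signature below is byte-identical to the landed theorem. -/
theorem stub_localRarityOfExtinct :
    ∀ (Nf : ℕ) (reg : QCDRegularisation Nf) (c : ℝ) (m : Fin Nf → ℝ), 0 < c → (∀ f, 0 < m f) →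
      (∀ ε : ℝ, 0 < ε → ∀ᶠ k in atTop, ∀ S : ℕ, reg.L k ≤ S → qcdPhaseQuenchedExpect (reg.β k) (2 * S + 1) (fun f => reg.mcrit k + reg.a k * m f / reg.Zm k) (fun U => ∑ f : Fin Nf, ((Multiset.countP (fun z : ℂ => z.im = 0 ∧ z.re < -(reg.mcrit k + reg.a k * m f / reg.Zm k)) (wilsonDirac (fundamentalRep (Fin 3)) U 0 1).charpoly.roots : ℝ) + (Multiset.countP (fun z : ℂ => |z.re| < c * (reg.a k * m f / reg.Zm k)) (spinorLift gammaFive * wilsonDirac (fundamentalRep (Fin 3)) U (reg.mcrit k + reg.a k * m f / reg.Zm k) 1).charpoly.roots : ℝ))) ≤ ε * ((2 * S + 1 : ℝ) / (2 * reg.L k + 1)) ^ 4) →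
      ∀ ε : ℝ, 0 < ε → ∀ᶠ k : ℕ in atTop, ∀ S : ℕ, reg.L k ≤ S →
        ∀ (f : Fin Nf) (x₀ : TorusSite 4 (2 * S + 1)) (r : ℕ) (τ : ℝ), 0 < τ → τ ≤ (c * (reg.a k * m f / reg.Zm k)) →
          qcdPhaseQuenchedExpect (reg.β k) (2 * S + 1) (fun fl => reg.mcrit k + reg.a k * m fl / reg.Zm k)
              (fun U : GaugeConfig 4 (2 * S + 1) SU3 => if (∃ φ : Idx (2 * S + 1) 3 → ℂ, φ ≠ 0 ∧ (∀ p, r < torusTaxiDist p.1 x₀ → φ p = 0) ∧ ∑ p, ‖(hermitianWilsonDirac (fundamentalRep (Fin 3)) U (reg.mcrit k + reg.a k * m f / reg.Zm k) 1 *ᵥ φ) p‖ ^ 2 < τ ^ 2 * ∑ p, ‖φ p‖ ^ 2) then (1 : ℝ) else 0) ≤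
            ε * ((4 * (r : ℝ) + 5) ^ 4 / (2 * reg.L k + 1) ^ 4) := by
  sorry

/-! **Stub R2 `stub_localRarityOfExtinct` is LANDED (p173605, `Theorems/…StubLocalRarityOfExtinct.lean`, 391 lines, lead c6 wave 1)**:
local rarity of bad balls `⟨1_{B(x₀,r) bad at level τ ≤ w_f(k)}⟩₊ ≤ ε(4r+5)⁴/(2L_k+1)⁴` from EXTINCT (maximal separated family +
`stub_wellBudget`, translation covariance/invariance); public helpers `locRar_card_bad_le`, `locRar_measurableSet_bad` (the bad event is
open), `locRar_qcdPhaseQuenchedExpect_comp_torusConfigShift` (`⟨F ∘ τ_v⟩₊ = ⟨F⟩₊`), `locRar_bad_iff_bad_torusConfigShift`,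
`locRar_hermitianWilsonDirac_torusConfigShift`, `locRar_hermitianWilsonDirac_mulVec_eq_zero` (range one). -/

/-- **Stub D2′ (`stub_leastSquaresCombesThomas`) — COMBES–THOMAS FOR THE LEAST-SQUARES LOCAL INVERSE at the rate of the
COERCIVITY LEVEL (ABSTRACT, PROVABLE NOW; v9).** Let `dist` be an `ℕ`-valued pseudo-metric on a finite index type, `A` a range-one
matrix (`A i j ≠ 0 → dist i j ≤ 1`) with absolute off-diagonal row and column sums `≤ h`, `B` a set of indices on which `A` is
COERCIVE at level `τ ∈ (0,1]`: `τ²‖v‖² ≤ ‖A v‖²` for every `v` supported in `B`, and `θ ≥ 0` with `h(e^θ − 1) ≤ τ/4`. Put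
`P := diag(1_B)` and `M := P Aᴴ A P + (1 − P)`. Then `M` is invertible and `‖(M⁻¹) i j‖ ≤ (16/(7τ²)) e^{−θ dist(i,j)}` — the rate is
proportional to `τ` (first order), NOT to the spectral gap `τ²` of the second-order operator `P Aᴴ A P`. Proof (Combes–Thomas with the
square-root trick): conjugating by `e^{f}`, `f = θ dist(·, j)`, gives `M_f = P (A + E′)ᴴ (A + E) P + (1 − P)` with `‖E‖, ‖E′‖ ≤ η :=
h(e^θ − 1)` (Schur test, `sum_norm_sq_mulVec_le_of_rowSum_le_of_colSum_le`); for `a := A P v`, `‖a‖ ≥ τ‖Pv‖` and `η ≤ τ/4`: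
`Re⟨v, M_f v⟩ ≥ ‖a‖² − 2η‖a‖‖Pv‖ − η²‖Pv‖² + ‖(1−P)v‖² ≥ (7/16)τ²‖Pv‖² + ‖(1−P)v‖² ≥ (7τ²/16)‖v‖²` (`τ ≤ 1`), so `‖M_f⁻¹‖ ≤ 16/(7τ²)`
and `M⁻¹(i,j) = e^{−θ dist(i,j)} M_f⁻¹(i,j)`. USE (K_FM): `Q := M⁻¹ P Aᴴ` is a LEFT INVERSE of `A` on `ℓ²(B)` (`Q A P = P`), whence the
least-squares resolvent identity `P A⁻¹ = Q − Q A (1 − P) A⁻¹` (three lines) with a remainder supported on the two boundary layers of `B`;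
with `A = Γ₅D_W − iη` the coercivity on `B` is EXACTLY the complement of the bad-ball event of A/R2 (`‖(H − iη)φ‖² = ‖Hφ‖² + η²‖φ‖²`
for `φ ⊆ B`), so the SAME event carries rarity (R2), the a priori bound (A) and the decay (this stub) — closing v8's named gap (1).
Model: `Literature.Analysis.Matrix.CoerciveCombesThomas.coercive_combes_thomas` (square coercive case). [cite: AizenmanWarzel2015 §10.3;
CombesThomas1973; ChulaevskySuhov2014 Thm 2.3.3] -/
theorem stub_leastSquaresCombesThomas :
    ∀ {n : Type} [Fintype n] [DecidableEq n] (dist : n → n → ℕ), (∀ i, dist i i = 0) → (∀ i j, dist i j = dist j i) →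
      (∀ i j l, dist i l ≤ dist i j + dist j l) →
      ∀ (A : Matrix n n ℂ), (∀ i j, A i j ≠ 0 → dist i j ≤ 1) →
      ∀ (h : ℝ), (∀ i, ∑ j ∈ Finset.univ.filter (fun j => dist i j ≠ 0), ‖A i j‖ ≤ h) →
        (∀ j, ∑ i ∈ Finset.univ.filter (fun i => dist i j ≠ 0), ‖A i j‖ ≤ h) →
      ∀ (B : Finset n) (τ θ : ℝ), 0 < τ → τ ≤ 1 → 0 ≤ θ → h * (Real.exp θ - 1) ≤ τ / 4 →
      (∀ v : n → ℂ, (∀ i, i ∉ B → v i = 0) → τ ^ 2 * ∑ i, ‖v i‖ ^ 2 ≤ ∑ i, ‖(A *ᵥ v) i‖ ^ 2) →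
      ∀ (P M : Matrix n n ℂ), P = Matrix.diagonal (fun i => if i ∈ B then (1 : ℂ) else 0) →
        M = P * Aᴴ * A * P + (1 - P) →
        IsUnit M.det ∧ ∀ i j, ‖M⁻¹ i j‖ ≤ 16 / (7 * τ ^ 2) * Real.exp (-(θ * dist i j)) := by
  sorry

/-- **Stub D3 (`stub_subharmonicDecay`) — SUBHARMONICITY ⇒ EXPONENTIAL DECAY (ABSTRACT, PROVABLE NOW; v9).** On an index type with
an `ℕ`-valued "distance" satisfying the triangle inequality, let `f` be bounded by `M` and `b ≥ 0`; if every point `i` farther than `ℓ`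
from `y` has a point `u` within `ℓ + 1` of `i` with `f i ≤ b · f u` (this is what the single-scale fractional-moment criterion delivers:
`f(i) ≤ Σ_{u} K(i,u) f(u)` with `Σ_u K(i,u) ≤ b`, `u` on the boundary layers of `B(i,ℓ)`, and `u` the maximiser), then
`f i ≤ M · b^{⌊dist(i,y)/(ℓ+1)⌋}` for every `i`. Proof: induction on `n ≤ dist(i,y)/(ℓ+1)` (`dist(u,y) ≥ dist(i,y) − (ℓ+1)`).
[cite: AizenmanEtAl2001 §3 (iteration of the finite-volume criterion); folklore] -/
theorem stub_subharmonicDecay :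
    ∀ {ι : Type} (dist : ι → ι → ℕ), (∀ i j l, dist i l ≤ dist i j + dist j l) →
      ∀ (f : ι → ℝ) (y : ι) (ℓ : ℕ) (b M : ℝ), 0 ≤ b → (∀ i, f i ≤ M) →
      (∀ i, ℓ < dist i y → ∃ u, dist i u ≤ ℓ + 1 ∧ f i ≤ b * f u) →
      ∀ i, f i ≤ M * b ^ (dist i y / (ℓ + 1)) := by
  sorry

/-- **Stub D4 (`stub_smallBallLayerCake`) — HÖLDER SMALL BALL ⇒ FRACTIONAL MOMENT (ABSTRACT LAYER CAKE, PROVABLE NOW; v9).** For a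
finite measure `μ`, a measurable `X ≥ 0` (the coercivity level of a ball, e.g. the smallest singular value of `H·P_B`), a scale `w > 0`,
`θ ∈ (0,1]`, exponents `0 < s < α` and `K ≥ 0` with the small-ball bound `μ{X < τ} ≤ K (τ/w)^α` for all `0 < τ ≤ θw` (the shape of A's
conclusion, `μ = F·⟨·⟩₊`): `∫_{X < θw} X^{−s} dμ ≤ K θ^α (α/(α−s)) (θw)^{−s}`. Proof: layer cake, `∫_{X<θw} X^{−s} = ∫₀^∞ μ{X < θw,
X^{−s} > t} dt ≤ (θw)^{−s} K θ^α + ∫_{(θw)^{−s}}^∞ K (t^{−1/s}/w)^α dt`, and `∫_{T₀}^∞ t^{−α/s} dt = T₀^{1−α/s} s/(α−s)`. USE (K_FM): the a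
priori fractional-moment bound of the least-squares local inverse on a bad ball, `⟨F·‖Q_B‖^s·1_bad⟩₊ ≤ C(Z/a)^p θ^{α−s} w^{−s} α/(α−s)·⟨F⟩₊`
(`‖Q_B‖ ≤ 16·h/(7X²)`-free version: `‖Q_B‖ = 1/X`). [cite: AizenmanEtAl2001 App. A; folklore (Mathlib `MeasureTheory.Integral.Layercake`)] -/
theorem stub_smallBallLayerCake :
    ∀ {Ω : Type} [MeasurableSpace Ω] (μ : Measure Ω) [IsFiniteMeasure μ] (X : Ω → ℝ), Measurable X → (∀ ω, 0 ≤ X ω) →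
      ∀ (w θ α s K : ℝ), 0 < w → 0 < θ → θ ≤ 1 → 0 < s → s < α → 0 ≤ K →
      (∀ τ : ℝ, 0 < τ → τ ≤ θ * w → μ {ω | X ω < τ} ≤ ENNReal.ofReal (K * (τ / w) ^ α)) →
      ∫⁻ ω in {ω | X ω < θ * w}, ENNReal.ofReal ((X ω)⁻¹ ^ s) ∂μ ≤
        ENNReal.ofReal (K * θ ^ α * (α / (α - s)) * (θ * w)⁻¹ ^ s) := by
  sorry

/-- **Stub K_FM (`stub_kinematicBandScreening`) — KINEMATIC BAND SCREENING: phase-quenched FRACTIONAL MOMENTS of the resolvent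
`(Γ₅D_W(U, m_f(k), 1) − iη)⁻¹`, `η ∈ (0,1]`, local IN MEAN at the kinematic rate (OPEN, size L–XL; v8; v9: takes D2′, D3, D4 by name
and its design is fixed to the LEAST-SQUARES local inverse).** Given D2′, D3, D4, local rarity R2 and the conditional small ball A (by
name, full forms), for `N_f ∈ {2,3}`, an SD⁺ witness `(reg, M₀, c)` read phase-quenched and POLYGROWTH: for every tuple `m > M₀` there are
`s ∈ (0,1)`, `κ, C > 0` and `p` with, eventually in `k`, on every torus `2S+1 ≥ 2L_k+1`, for all `η ∈ (0,1]`, flavours `f` and sites `x, y`: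
`⟨ Σ_{p,q} ‖((Γ₅D_W(U,m_f(k),1) − iη)⁻¹)((x,p),(y,q))‖^s ⟩₊ ≤ C (Z_k/a_k)^p exp(−κ w_f(k) |x−y|₁)`, `w_f(k) = c a_k m_f/Z_k`. This is
weyl-window's Stub 2 `stub_bandScreening` ("stub-blocked: none in tree — a localisation THEOREM") RE-TYPED KINEMATICALLY (rate `κ w_f(k)`,
constant polynomial in `Z_k/a_k`). DESIGN (v9): single-scale fractional-moment criterion (Aizenman–Schenker–Friedrich–Hundertmark 2001) run
on the LEAST-SQUARES local inverse `Q_B = (P Aᴴ A P + 1 − P)⁻¹ P Aᴴ` of `A = Γ₅D_W − iη` on balls `B = B(x, ℓ_k)`,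
`ℓ_k ≍ (p′/κ₀) log(Z_k/a_k)/(θw)`: (i) `P A⁻¹ = Q_B − Q_B A (1−P) A⁻¹` puts the remainder on the two boundary layers; (ii) on a GOOD ball
(no quasi-mode of level `θw` supported in `B` — EXACTLY the complement of A's/R2's event, since `‖(H−iη)φ‖² = ‖Hφ‖² + η²‖φ‖²`) D2′ gives
`|Q_B(x,u)| ≤ (16·10/(7θ²w²)) e^{−θ′ℓ}`, `θ′ ≍ θw/40`; (iii) on a BAD ball `‖Q_B‖ = 1/σ_min` has fractional mean `≤ C(Z/a)^p θ^{α−s} w^{−s}`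
by A + D4, and bad balls are RARE by R2; (iv) D3 iterates the resulting subharmonicity. NAMED GAPS (numbers, not adjectives): (2) BUDGET —
the criterion's small parameter is `b ≍ ℓ³ · [e^{−sθ′ℓ}(θw)^{−2s} + (a priori bad-ball term)]·(decoupling constant)`, and the bad-ball term is
small only through rarity `P₊(bad) ≤ ε(4ℓ+5)⁴/(2L_k+1)⁴ ≍ ε Z⁴ a_k^{4q}` (POLYGROWTH exponent `q`, entering with a Hölder power) against
the polynomial losses `ℓ³·ℓ⁴·w^{−s} ≍ a_k^{−7−s}` (surface × A's ball-volume union bound × level): the single-scale criterion closes only for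
`q` ABOVE a threshold `q₀(p_A, α, s) ≳ 2`, which POLYGROWTH (`∃ q > 0`) does not guarantee — and heuristically EXTINCT itself CAPS `q`
(window modes from dislocations/small instantons number `≍ L_k⁴ a_k^γ` per torus, so `ε` per `L_k`-box forces `L_k ≲ a_k^{−γ/4}`): the
consistent regime `q₀ < q < γ/4 − 1` may be narrow or empty — a CLASS question for the planners/disprover, recorded, not hidden; (3) DECOUPLING —
the iteration needs an a priori TWO-CELL conditional fractional-moment bound `sup_ext ∫∫ ‖A⁻¹(u′,y)‖^s dHaar(cell u′) dHaar(cell y) ≤ C w^{−s}(Z/a)^p`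
(the analogue of ASFH's Lemma 2.1 for unitary link disorder; 8966/W currency, NOT supplied by A, which is a one-ball small-ball bound).
Landed and importable (not hypotheses): L, S1, K2, W1–W4 `stub_windowModesLocalised`, `stub_badBoxLocal`, the CT family, R2's translation
helpers. [AizenmanEtAl2001 Thm 1.2, Lemma 2.1, §3; AizenmanMolchanov1993; AizenmanGraf1998 §2; Aizenman–Warzel GSM 168 Ch. 11–13;
GerminetHislopKlein2007 (Poisson: why joint rarity needs independence); Stollmann2001 Ch. 3] -/
theorem stub_kinematicBandScreening :
    (∀ {n : Type} [Fintype n] [DecidableEq n] (dist : n → n → ℕ), (∀ i, dist i i = 0) → (∀ i j, dist i j = dist j i) →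
      (∀ i j l, dist i l ≤ dist i j + dist j l) →
      ∀ (A : Matrix n n ℂ), (∀ i j, A i j ≠ 0 → dist i j ≤ 1) →
      ∀ (h : ℝ), (∀ i, ∑ j ∈ Finset.univ.filter (fun j => dist i j ≠ 0), ‖A i j‖ ≤ h) →
        (∀ j, ∑ i ∈ Finset.univ.filter (fun i => dist i j ≠ 0), ‖A i j‖ ≤ h) →
      ∀ (B : Finset n) (τ θ : ℝ), 0 < τ → τ ≤ 1 → 0 ≤ θ → h * (Real.exp θ - 1) ≤ τ / 4 →
      (∀ v : n → ℂ, (∀ i, i ∉ B → v i = 0) → τ ^ 2 * ∑ i, ‖v i‖ ^ 2 ≤ ∑ i, ‖(A *ᵥ v) i‖ ^ 2) →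
      ∀ (P M : Matrix n n ℂ), P = Matrix.diagonal (fun i => if i ∈ B then (1 : ℂ) else 0) →
        M = P * Aᴴ * A * P + (1 - P) →
        IsUnit M.det ∧ ∀ i j, ‖M⁻¹ i j‖ ≤ 16 / (7 * τ ^ 2) * Real.exp (-(θ * dist i j))) →
    (∀ {ι : Type} (dist : ι → ι → ℕ), (∀ i j l, dist i l ≤ dist i j + dist j l) →
      ∀ (f : ι → ℝ) (y : ι) (ℓ : ℕ) (b M : ℝ), 0 ≤ b → (∀ i, f i ≤ M) →
      (∀ i, ℓ < dist i y → ∃ u, dist i u ≤ ℓ + 1 ∧ f i ≤ b * f u) →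
      ∀ i, f i ≤ M * b ^ (dist i y / (ℓ + 1))) →
    (∀ {Ω : Type} [MeasurableSpace Ω] (μ : Measure Ω) [IsFiniteMeasure μ] (X : Ω → ℝ), Measurable X → (∀ ω, 0 ≤ X ω) →
      ∀ (w θ α s K : ℝ), 0 < w → 0 < θ → θ ≤ 1 → 0 < s → s < α → 0 ≤ K →
      (∀ τ : ℝ, 0 < τ → τ ≤ θ * w → μ {ω | X ω < τ} ≤ ENNReal.ofReal (K * (τ / w) ^ α)) →
      ∫⁻ ω in {ω | X ω < θ * w}, ENNReal.ofReal ((X ω)⁻¹ ^ s) ∂μ ≤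
        ENNReal.ofReal (K * θ ^ α * (α / (α - s)) * (θ * w)⁻¹ ^ s)) →
    (∀ (Nf : ℕ) (reg : QCDRegularisation Nf) (c : ℝ) (m : Fin Nf → ℝ), 0 < c → (∀ f, 0 < m f) →
      (∀ ε : ℝ, 0 < ε → ∀ᶠ k in atTop, ∀ S : ℕ, reg.L k ≤ S → qcdPhaseQuenchedExpect (reg.β k) (2 * S + 1) (fun f => reg.mcrit k + reg.a k * m f / reg.Zm k) (fun U => ∑ f : Fin Nf, ((Multiset.countP (fun z : ℂ => z.im = 0 ∧ z.re < -(reg.mcrit k + reg.a k * m f / reg.Zm k)) (wilsonDirac (fundamentalRep (Fin 3)) U 0 1).charpoly.roots : ℝ) + (Multiset.countP (fun z : ℂ => |z.re| < c * (reg.a k * m f / reg.Zm k)) (spinorLift gammaFive * wilsonDirac (fundamentalRep (Fin 3)) U (reg.mcrit k + reg.a k * m f / reg.Zm k) 1).charpoly.roots : ℝ))) ≤ ε * ((2 * S + 1 : ℝ) / (2 * reg.L k + 1)) ^ 4) →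
      ∀ ε : ℝ, 0 < ε → ∀ᶠ k : ℕ in atTop, ∀ S : ℕ, reg.L k ≤ S →
        ∀ (f : Fin Nf) (x₀ : TorusSite 4 (2 * S + 1)) (r : ℕ) (τ : ℝ), 0 < τ → τ ≤ (c * (reg.a k * m f / reg.Zm k)) →
          qcdPhaseQuenchedExpect (reg.β k) (2 * S + 1) (fun fl => reg.mcrit k + reg.a k * m fl / reg.Zm k)
              (fun U : GaugeConfig 4 (2 * S + 1) SU3 => if (∃ φ : Idx (2 * S + 1) 3 → ℂ, φ ≠ 0 ∧ (∀ p, r < torusTaxiDist p.1 x₀ → φ p = 0) ∧ ∑ p, ‖(hermitianWilsonDirac (fundamentalRep (Fin 3)) U (reg.mcrit k + reg.a k * m f / reg.Zm k) 1 *ᵥ φ) p‖ ^ 2 < τ ^ 2 * ∑ p, ‖φ p‖ ^ 2) then (1 : ℝ) else 0) ≤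
            ε * ((4 * (r : ℝ) + 5) ^ 4 / (2 * reg.L k + 1) ^ 4)) →
    (∀ (Nf : ℕ), Nf = 2 ∨ Nf = 3 → ∀ (reg : QCDRegularisation Nf) (M₀ c : ℝ), 0 ≤ M₀ → 0 < c →
      reg.HasMassScaling → (reg.scheme 0 0 0).HasAsymptoticScaling →
      (∃ p : ℕ, ∀ᶠ k in atTop, (reg.L k : ℝ) ≤ (reg.a k)⁻¹ ^ p) → (∀ᶠ k in atTop, -1 < reg.mcrit k) →
      (∀ m : Fin Nf → ℝ, (∀ f, M₀ < m f) →
        (∀ ε : ℝ, 0 < ε → ∀ᶠ k in atTop, ∀ S : ℕ, reg.L k ≤ S → qcdPhaseQuenchedExpect (reg.β k) (2 * S + 1) (fun f => reg.mcrit k + reg.a k * m f / reg.Zm k) (fun U => ∑ f : Fin Nf, ((Multiset.countP (fun z : ℂ => z.im = 0 ∧ z.re < -(reg.mcrit k + reg.a k * m f / reg.Zm k)) (wilsonDirac (fundamentalRep (Fin 3)) U 0 1).charpoly.roots : ℝ) + (Multiset.countP (fun z : ℂ => |z.re| < c * (reg.a k * m f / reg.Zm k)) (spinorLift gammaFive *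 wilsonDirac (fundamentalRep (Fin 3)) U (reg.mcrit k + reg.a k * m f / reg.Zm k) 1).charpoly.roots : ℝ))) ≤ ε * ((2 * S + 1 : ℝ) / (2 * reg.L k + 1)) ^ 4) ∧
        (∃ η : ℝ, 0 < η ∧ ∀ M : ℝ, M₀ < M → ∀ᶠ k in atTop, max 1 (η * (reg.a k * (2 * reg.L k + 1 : ℝ)) ^ 2) ≤ qcdPhaseQuenchedExpect (reg.β k) (2 * reg.L k + 1) (fun f => reg.mcrit k + reg.a k * m f / reg.Zm k) (fun U => |(Multiset.countP (fun z : ℂ => z.re < 0) (spinorLift gammaFive * wilsonDirac (fundamentalRep (Fin 3)) U (reg.mcrit k - reg.a k * M / reg.Zm k) 1).charpoly.roots : ℝ) - 6 * (2 * reg.L k + 1 : ℝ) ^ 4|))) →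
      ∃ R₀ : ℕ, ∃ α : ℝ, 0 < α ∧ α ≤ 1 ∧ ∀ m : Fin Nf → ℝ, (∀ f, M₀ < m f) → ∀ θ : ℝ, 0 < θ → θ < 1 →
        ∃ C p : ℝ, 0 < C ∧ ∀ᶠ k : ℕ in atTop, ∀ S : ℕ, reg.L k ≤ S →
          ∀ (f : Fin Nf) (x₀ : TorusSite 4 (2 * S + 1)) (r : ℕ), r ≤ reg.L k →
          ∀ τ : ℝ, 0 < τ → τ ≤ θ * (c * (reg.a k * m f / reg.Zm k)) →
          ∀ F : GaugeConfig 4 (2 * S + 1) SU3 → ℝ, Measurable F → (∀ U, 0 ≤ F U ∧ F U ≤ 1) →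
            (∀ U V : GaugeConfig 4 (2 * S + 1) SU3,
              (∀ e : TorusSite 4 (2 * S + 1) × Fin 4, r + R₀ < torusTaxiDist e.1 x₀ → U e = V e) → F U = F V) →
            qcdPhaseQuenchedExpect (reg.β k) (2 * S + 1) (fun fl => reg.mcrit k + reg.a k * m fl / reg.Zm k)
                (fun U : GaugeConfig 4 (2 * S + 1) SU3 =>
                  F U * (if (∃ φ : Idx (2 * S + 1) 3 → ℂ, φ ≠ 0 ∧ (∀ p, r < torusTaxiDist p.1 x₀ → φ p = 0) ∧ ∑ p, ‖(hermitianWilsonDirac (fundamentalRep (Fin 3)) U (reg.mcrit k + reg.a k * m f / reg.Zm k) 1 *ᵥ φ) p‖ ^ 2 < τ ^ 2 * ∑ p, ‖φ p‖ ^ 2) then (1 : ℝ) else 0)) ≤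
              C * ((reg.a k)⁻¹ * reg.Zm k) ^ p * (τ / (c * (reg.a k * m f / reg.Zm k))) ^ α *
                qcdPhaseQuenchedExpect (reg.β k) (2 * S + 1) (fun fl => reg.mcrit k + reg.a k * m fl / reg.Zm k) F) →
    ∀ (Nf : ℕ), Nf = 2 ∨ Nf = 3 → ∀ (reg : QCDRegularisation Nf) (M₀ c : ℝ), 0 ≤ M₀ → 0 < c →
      reg.HasMassScaling → (reg.scheme 0 0 0).HasAsymptoticScaling →
      (∃ p : ℕ, ∀ᶠ k in atTop, (reg.L k : ℝ) ≤ (reg.a k)⁻¹ ^ p) → (∀ᶠ k in atTop, -1 < reg.mcrit k) →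
      (∀ m : Fin Nf → ℝ, (∀ f, M₀ < m f) →
        (∀ ε : ℝ, 0 < ε → ∀ᶠ k in atTop, ∀ S : ℕ, reg.L k ≤ S → qcdPhaseQuenchedExpect (reg.β k) (2 * S + 1) (fun f => reg.mcrit k + reg.a k * m f / reg.Zm k) (fun U => ∑ f : Fin Nf, ((Multiset.countP (fun z : ℂ => z.im = 0 ∧ z.re < -(reg.mcrit k + reg.a k * m f / reg.Zm k)) (wilsonDirac (fundamentalRep (Fin 3)) U 0 1).charpoly.roots : ℝ) + (Multiset.countP (fun z : ℂ => |z.re| < c * (reg.a k * m f / reg.Zm k)) (spinorLift gammaFive * wilsonDirac (fundamentalRep (Fin 3)) U (reg.mcrit k + reg.a k * m f / reg.Zm k) 1).charpoly.roots : ℝ))) ≤ ε * ((2 * S + 1 : ℝ) / (2 * reg.L k + 1)) ^ 4) ∧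
        (∃ η : ℝ, 0 < η ∧ ∀ M : ℝ, M₀ < M → ∀ᶠ k in atTop, max 1 (η * (reg.a k * (2 * reg.L k + 1 : ℝ)) ^ 2) ≤ qcdPhaseQuenchedExpect (reg.β k) (2 * reg.L k + 1) (fun f => reg.mcrit k + reg.a k * m f / reg.Zm k) (fun U => |(Multiset.countP (fun z : ℂ => z.re < 0) (spinorLift gammaFive * wilsonDirac (fundamentalRep (Fin 3)) U (reg.mcrit k - reg.a k * M / reg.Zm k) 1).charpoly.roots : ℝ) - 6 * (2 * reg.L k + 1 : ℝ) ^ 4|))) →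
      (∃ q : ℝ, 0 < q ∧ ∀ᶠ k in atTop, (reg.a k)⁻¹ ^ q ≤ reg.a k * (reg.L k : ℝ)) →
      ∀ m : Fin Nf → ℝ, (∀ f, M₀ < m f) →
        ∃ s κ C p : ℝ, 0 < s ∧ s < 1 ∧ 0 < κ ∧ 0 < C ∧ ∀ᶠ k : ℕ in atTop, ∀ S : ℕ, reg.L k ≤ S →
          ∀ η : ℝ, 0 < η → η ≤ 1 → ∀ (f : Fin Nf) (x y : TorusSite 4 (2 * S + 1)),
            qcdPhaseQuenchedExpect (reg.β k) (2 * S + 1) (fun fl => reg.mcrit k + reg.a k * m fl / reg.Zm k)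
                (fun U : GaugeConfig 4 (2 * S + 1) SU3 => ∑ p : Fin 3 × Fin 4, ∑ q : Fin 3 × Fin 4,
                  ‖((spinorLift gammaFive * wilsonDirac (fundamentalRep (Fin 3)) U
                          (reg.mcrit k + reg.a k * m f / reg.Zm k) 1 - ((η : ℂ) * Complex.I) • 1)⁻¹ :
                      Matrix (TorusSite 4 (2 * S + 1) × Fin 3 × Fin 4) (TorusSite 4 (2 * S + 1) × Fin 3 × Fin 4) ℂ)
                    (x, p) (y, q)‖ ^ s) ≤
              C * ((reg.a k)⁻¹ * reg.Zm k) ^ p *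
                Real.exp (-(κ * (c * (reg.a k * m f / reg.Zm k)) * (torusTaxiDist x y : ℝ))) := by
  sorry

/-- **PLACEHOLDER for the LANDED stub `stub_signScreeningOfBand` (p173045, lead c6 wave 1)** — a `sorry` here ONLY because the farm had not yet built the landed module at registration time (`remote:stale:unbuilt`); replaced by the import at the next publication. The registered signature below is byte-identical to the landed theorem. -/
theorem stub_signScreeningOfBand :
    ∀ (Nf : ℕ), Nf = 2 ∨ Nf = 3 → ∀ (reg : QCDRegularisation Nf) (c : ℝ) (m : Fin Nf → ℝ), 0 < c → (∀ f, 0 < m f) →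
      reg.HasMassScaling → (∀ᶠ k in atTop, -1 < reg.mcrit k) →
      (∀ᶠ k in atTop, ∀ f, |reg.mcrit k + reg.a k * m f / reg.Zm k| ≤ 1) →
      (∃ s κ C p : ℝ, 0 < s ∧ s < 1 ∧ 0 < κ ∧ 0 < C ∧ ∀ᶠ k : ℕ in atTop, ∀ S : ℕ, reg.L k ≤ S →
          ∀ η : ℝ, 0 < η → η ≤ 1 → ∀ (f : Fin Nf) (x y : TorusSite 4 (2 * S + 1)),
            qcdPhaseQuenchedExpect (reg.β k) (2 * S + 1) (fun fl => reg.mcrit k + reg.a k * m fl / reg.Zm k)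
                (fun U : GaugeConfig 4 (2 * S + 1) SU3 => ∑ p : Fin 3 × Fin 4, ∑ q : Fin 3 × Fin 4,
                  ‖((spinorLift gammaFive * wilsonDirac (fundamentalRep (Fin 3)) U
                          (reg.mcrit k + reg.a k * m f / reg.Zm k) 1 - ((η : ℂ) * Complex.I) • 1)⁻¹ :
                      Matrix (TorusSite 4 (2 * S + 1) × Fin 3 × Fin 4) (TorusSite 4 (2 * S + 1) × Fin 3 × Fin 4) ℂ)
                    (x, p) (y, q)‖ ^ s) ≤
              C * ((reg.a k)⁻¹ * reg.Zm k) ^ p *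
                Real.exp (-(κ * (c * (reg.a k * m f / reg.Zm k)) * (torusTaxiDist x y : ℝ)))) →
        ∃ κ C p : ℝ, 0 < κ ∧ 0 < C ∧ ∀ᶠ k : ℕ in atTop, ∀ S : ℕ, reg.L k ≤ S →
          ∀ (f : Fin Nf) (x y : TorusSite 4 (2 * S + 1)),
            qcdPhaseQuenchedExpect (reg.β k) (2 * S + 1) (fun fl => reg.mcrit k + reg.a k * m fl / reg.Zm k)
                (fun U : GaugeConfig 4 (2 * S + 1) SU3 => ∑ p : Fin 3 × Fin 4, ∑ q : Fin 3 × Fin 4,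
                  ‖(cfc Real.sign (spinorLift gammaFive * wilsonDirac (fundamentalRep (Fin 3)) U
                      (reg.mcrit k + reg.a k * m f / reg.Zm k) 1) :
                    Matrix (TorusSite 4 (2 * S + 1) × Fin 3 × Fin 4) (TorusSite 4 (2 * S + 1) × Fin 3 × Fin 4) ℂ)
                    (x, p) (y, q)‖) ≤
              C * ((reg.a k)⁻¹ * reg.Zm k) ^ p *
                Real.exp (-(κ * (c * (reg.a k * m f / reg.Zm k)) * (torusTaxiDist x y : ℝ))) := by
  sorry

/-! **Stub K_AG `stub_signScreeningOfBand` is LANDED (p173045, `Theorems/…StubSignScreeningOfBand.lean`, 153 lines, lead c6 wave 1)**: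
band screening ⇒ sign screening at the kinematic rate (`κ′ = min κ (1/(800c))`, `C′ = 2C/s + 10368`, `p′ = max p 0`), by the landed
`WeylWindow.stub_aizenmanGrafInMean` family. -/

/-! **Stub K `stub_kinematicScreening` (v2–v7) is RESHAPED (v8, lead c6)** through weyl-window's LANDED Aizenman–Graf reduction
(`stub_aizenmanGrafInMean`, `stub_aizenmanGrafPointwise`, `stub_signKernelResolventBound`, `stub_arctanKernelLocality`,
`stub_hermitianWilsonCombesThomas`, `stub_massPinAbsLeOne`): K = K_AG ∘ K_FM with K_AG `stub_signScreeningOfBand` PROVABLE NOW and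
K_FM `stub_kinematicBandScreening` the research residual in the standard fractional-moment currency, fed the new PROVABLE-NOW local
rarity stub R2 `stub_localRarityOfExtinct` and A. K's conclusion (consumed by G) is byte-identical to v7. -/

/-- **Stub G (`stub_signedLatticeGapKinematic`) — THE SIGNED LATTICE GAP ON ALL TORI by a sign-defect expansion at KINEMATIC
range (OPEN, size XL; the re-typed Stub 5 of weyl-window).** Given sign-cocycle locality (LANDED p104175, taken by name), the
rate lever R and kinematic screening K (as a hypothesis in its full form): for `N_f ∈ {2,3}`, an SD⁺ witness read phase-quenched,
POLYGROWTH, and every tuple `m > M₀`, there is `Δ > 0` with `(reg.scheme m z shift).HasLatticeMassGap Δ` for all species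
renormalisations `(z, shift)` (the predicate does not read them): connected Euclidean-time correlations of ALL gauge-invariant local
lattice QCD observables of the HONEST signed theory decay at rate `Δ a_k n` on every torus `S ≥ L_k`, eventually in `k`.
Intended proof (card Lever (2) + §(4)): Kotecký–Preiss for `log⟨σ · e^{sources}⟩₊`, `σ = ∏_f (−1)^{n₋(Γ₅D_W(m_f(k))) − 6(2S+1)⁴}`
(tree `fermionDet_wilsonDirac_eq_sign_mul` + chiral inertia): ACTIVITIES supported on sign-defect clusters, LOCAL at the kinematic
range `R_k = Z_k/(κ c a_k m_f)` by the cocycle (deterministic, off the window) and K (in mean, through the window); DILUTE with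
first-moment density `ρ_k ≤ ε/(2L_k+1)⁴` per site (EXTINCT, intensive normalisation) so that `ρ_k R_k⁴ → 0` under POLYGROWTH ⊃
GROWTH; RATE per lattice unit `(1/R_k) log(1/(Cρ_kR_k⁴))`, which in physical units is `≥ (κ c m_f/Z_k)(4q log a_k⁻¹ − 4 log Z_k − K)
→ +∞` by R — so the sign corrections are eventually heavier than any physical gap and `Δ` is the reference's clustering rate.
NAMED BURDENS, not supplied by the hypotheses and not hidden: (JR) joint rarity `P₊(n separated cells all defective) ≤ ρ̂ⁿ` from a
DLR-uniform local rarity (a conditional strengthening of EXTINCT(b)); ratio-mixing / physical-rate clustering of the NON-LOCAL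
positive reference `e^{−βS}∏|det|` on all tori (the lattice half of the core — Yang–Mills grade; tree has strong coupling only,
`osterwalder_seiler_strongCoupling`); OS positivity of the honest side (BRANCH: `m_f(k) > −1`) to read clustering as
`HasLatticeMassGap`; and `FullLatticeGap` stmt-8928 is contained in the conclusion on any witness. Free special case: `N_f = 2`,
`m_u = m_d` (`σ ≡ +1` a.e.). [KoteckyPreiss1986; Luscher1977; OsterwalderSeiler1978; Seiler1982 Ch. 3; AizenmanGraf1998;
MohlerSchaefer2020 §2.1] -/
theorem stub_signedLatticeGapKinematic :
    (∃ C : ℝ, 0 < C ∧ ∀ (L : ℕ) [NeZero L] (t m₀ : ℝ), 0 < t → t ≤ 1 → |m₀| ≤ 1 →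
      ∀ (x₀ : TorusSite 4 L) (R ℓ : ℕ), C * (1 + Real.log (L : ℝ)) / t ≤ (ℓ : ℝ) →
      ∀ (U₁ V₁ U₂ V₂ : GaugeConfig 4 L SU3),
        (∀ e : TorusSite 4 L × Fin 4, R < torusTaxiDist e.1 x₀ → V₁ e = U₁ e ∧ V₂ e = U₂ e) →
        (∀ e : TorusSite 4 L × Fin 4, torusTaxiDist e.1 x₀ ≤ R + ℓ → U₂ e = U₁ e ∧ V₂ e = V₁ e) →
        (∀ U ∈ [U₁, V₁, U₂, V₂], Multiset.countP (fun z : ℂ => |z.re| < t)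
          (spinorLift gammaFive * wilsonDirac (fundamentalRep (Fin 3)) U m₀ 1).charpoly.roots = 0) →
        (Multiset.countP (fun z : ℂ => z.re < 0)
            (spinorLift gammaFive * wilsonDirac (fundamentalRep (Fin 3)) V₁ m₀ 1).charpoly.roots : ℤ) -
          Multiset.countP (fun z : ℂ => z.re < 0)
            (spinorLift gammaFive * wilsonDirac (fundamentalRep (Fin 3)) U₁ m₀ 1).charpoly.roots =
        (Multiset.countP (fun z : ℂ => z.re < 0)
            (spinorLift gammaFive * wilsonDirac (fundamentalRep (Fin 3)) V₂ m₀ 1).charpoly.roots : ℤ) -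
          Multiset.countP (fun z : ℂ => z.re < 0)
            (spinorLift gammaFive * wilsonDirac (fundamentalRep (Fin 3)) U₂ m₀ 1).charpoly.roots) →
    (∀ (x Z ℓog : ℕ → ℝ) (q γ C : ℝ), 0 < q → γ < 1 → 0 < C → Tendsto x atTop atTop → (∀ k, 0 < Z k) →
      (∀ᶠ k in atTop, Z k ≤ C * (x k) ^ γ) → (∀ᶠ k in atTop, q * x k ≤ ℓog k) →
      ∀ (m : ℝ), 0 < m → ∀ K : ℝ, Tendsto (fun k => m / Z k * (ℓog k - Real.log (Z k) - K)) atTop atTop) →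
    (∀ (Nf : ℕ), Nf = 2 ∨ Nf = 3 → ∀ (reg : QCDRegularisation Nf) (M₀ c : ℝ), 0 ≤ M₀ → 0 < c →
      reg.HasMassScaling → (reg.scheme 0 0 0).HasAsymptoticScaling →
      (∃ p : ℕ, ∀ᶠ k in atTop, (reg.L k : ℝ) ≤ (reg.a k)⁻¹ ^ p) → (∀ᶠ k in atTop, -1 < reg.mcrit k) →
      (∀ m : Fin Nf → ℝ, (∀ f, M₀ < m f) →
        (∀ ε : ℝ, 0 < ε → ∀ᶠ k in atTop, ∀ S : ℕ, reg.L k ≤ S → qcdPhaseQuenchedExpect (reg.β k) (2 * S + 1) (fun f => reg.mcrit k + reg.a k * m f / reg.Zm k) (fun U => ∑ f : Fin Nf, ((Multiset.countP (fun z : ℂ => z.im = 0 ∧ z.re < -(reg.mcrit k + reg.a k * m f / reg.Zm k)) (wilsonDirac (fundamentalRep (Fin 3)) U 0 1).charpoly.roots : ℝ) + (Multiset.countP (fun z : ℂ => |z.re| < c * (reg.a k * m f / reg.Zm k)) (spinorLift gammaFive * wilsonDirac (fundamentalRep (Fin 3)) U (reg.mcrit k + reg.a k * m f / reg.Zm k)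 1).charpoly.roots : ℝ))) ≤ ε * ((2 * S + 1 : ℝ) / (2 * reg.L k + 1)) ^ 4) ∧
        (∃ η : ℝ, 0 < η ∧ ∀ M : ℝ, M₀ < M → ∀ᶠ k in atTop, max 1 (η * (reg.a k * (2 * reg.L k + 1 : ℝ)) ^ 2) ≤ qcdPhaseQuenchedExpect (reg.β k) (2 * reg.L k + 1) (fun f => reg.mcrit k + reg.a k * m f / reg.Zm k) (fun U => |(Multiset.countP (fun z : ℂ => z.re < 0) (spinorLift gammaFive * wilsonDirac (fundamentalRep (Fin 3)) U (reg.mcrit k - reg.a k * M / reg.Zm k) 1).charpoly.roots : ℝ) - 6 * (2 * reg.L k + 1 : ℝ) ^ 4|))) →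
      (∃ q : ℝ, 0 < q ∧ ∀ᶠ k in atTop, (reg.a k)⁻¹ ^ q ≤ reg.a k * (reg.L k : ℝ)) →
      ∀ m : Fin Nf → ℝ, (∀ f, M₀ < m f) →
        ∃ κ C p : ℝ, 0 < κ ∧ 0 < C ∧ ∀ᶠ k : ℕ in atTop, ∀ S : ℕ, reg.L k ≤ S →
          ∀ (f : Fin Nf) (x y : TorusSite 4 (2 * S + 1)),
            qcdPhaseQuenchedExpect (reg.β k) (2 * S + 1) (fun fl => reg.mcrit k + reg.a k * m fl / reg.Zm k)
                (fun U : GaugeConfig 4 (2 * S + 1) SU3 => ∑ p : Fin 3 × Fin 4, ∑ q : Fin 3 × Fin 4,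
                  ‖(cfc Real.sign (spinorLift gammaFive * wilsonDirac (fundamentalRep (Fin 3)) U
                      (reg.mcrit k + reg.a k * m f / reg.Zm k) 1) :
                    Matrix (TorusSite 4 (2 * S + 1) × Fin 3 × Fin 4) (TorusSite 4 (2 * S + 1) × Fin 3 × Fin 4) ℂ)
                    (x, p) (y, q)‖) ≤
              C * ((reg.a k)⁻¹ * reg.Zm k) ^ p *
                Real.exp (-(κ * (c * (reg.a k * m f / reg.Zm k)) * (torusTaxiDist x y : ℝ)))) →
    ∀ (Nf : ℕ), Nf = 2 ∨ Nf = 3 → ∀ (reg : QCDRegularisation Nf) (M₀ c : ℝ), 0 ≤ M₀ → 0 < c →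
      reg.HasMassScaling → (reg.scheme 0 0 0).HasAsymptoticScaling →
      (∃ p : ℕ, ∀ᶠ k in atTop, (reg.L k : ℝ) ≤ (reg.a k)⁻¹ ^ p) → (∀ᶠ k in atTop, -1 < reg.mcrit k) →
      (∀ m : Fin Nf → ℝ, (∀ f, M₀ < m f) →
        (∀ ε : ℝ, 0 < ε → ∀ᶠ k in atTop, ∀ S : ℕ, reg.L k ≤ S → qcdPhaseQuenchedExpect (reg.β k) (2 * S + 1) (fun f => reg.mcrit k + reg.a k * m f / reg.Zm k) (fun U => ∑ f : Fin Nf, ((Multiset.countP (fun z : ℂ => z.im = 0 ∧ z.re < -(reg.mcrit k + reg.a k * m f / reg.Zm k)) (wilsonDirac (fundamentalRep (Fin 3)) U 0 1).charpoly.roots : ℝ) + (Multiset.countP (fun z : ℂ => |z.re| < c * (reg.a k * m f / reg.Zm k)) (spinorLift gammaFive * wilsonDirac (fundamentalRep (Fin 3)) U (reg.mcrit k + reg.a k * m f / reg.Zm k) 1).charpoly.roots : ℝ))) ≤ ε * ((2 * S + 1 : ℝ) / (2 * reg.L k + 1)) ^ 4) ∧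
        (∃ η : ℝ, 0 < η ∧ ∀ M : ℝ, M₀ < M → ∀ᶠ k in atTop, max 1 (η * (reg.a k * (2 * reg.L k + 1 : ℝ)) ^ 2) ≤ qcdPhaseQuenchedExpect (reg.β k) (2 * reg.L k + 1) (fun f => reg.mcrit k + reg.a k * m f / reg.Zm k) (fun U => |(Multiset.countP (fun z : ℂ => z.re < 0) (spinorLift gammaFive * wilsonDirac (fundamentalRep (Fin 3)) U (reg.mcrit k - reg.a k * M / reg.Zm k) 1).charpoly.roots : ℝ) - 6 * (2 * reg.L k + 1 : ℝ) ^ 4|))) →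
      (∃ q : ℝ, 0 < q ∧ ∀ᶠ k in atTop, (reg.a k)⁻¹ ^ q ≤ reg.a k * (reg.L k : ℝ)) →
      ∀ m : Fin Nf → ℝ, (∀ f, M₀ < m f) →
        ∃ Δ > 0, ∀ (z shift : QCDField Nf → ℕ → ℝ), (reg.scheme m z shift).HasLatticeMassGap Δ := by
  sorry

/-- **Stub S (`stub_signDefectRegularity`) — SIGN-DEFECT REGULARITY of the honest Berezin numerator along `φ` (OPEN; weyl-window
3b under this line's prefix; the scheme-volume sign input).** Given sign-cocycle locality (LANDED, by name), for `N_f ∈ {2,3}`, an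
SD⁺ witness read phase-quenched, every tuple `m > M₀`, all `(z, shift)`, every strictly increasing `φ` along which the phase-quenched
Schwinger functions of `reg.scheme m z shift` converge (to some OS data), and every off-diagonal tensor string:
`‖∫ N_{φk} dμ_W − ∫ W·N_{φk} dμ_W‖ ≤ ε ∫ |det D| dμ_W` eventually in `k`, for every `ε > 0` (`W = qcdDetPhase`, the determinant
sign) — the sign-defective part of the honest numerator is `o(∫|det D|)`. Consumed through the LANDED kernel reduction
`WeylWindow.signTransfer_of_signDefectRegularity` (p101988: + EXTINCT at `S = L_{φk}` ⇒ honest − phase-quenched → 0). Intended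
proof: conditional cell expansion at the scheme volume (cells local by the cocycle, rare by EXTINCT; conditioning a renormalised
probe on `j` lattice-scale defects moves its mean by `≤ C(1+j)`); free true case `N_f = 2`, `m_u = m_d`. Worker verdict on record
(weyl-window c1): not derivable from the registered hypotheses by form-level manipulation — a genuine uniform-integrability input.
[MohlerSchaefer2020 §2.1; MontvayMunster1994 §5.1] -/
theorem stub_signDefectRegularity :
    (∃ C : ℝ, 0 < C ∧ ∀ (L : ℕ) [NeZero L] (t m₀ : ℝ), 0 < t → t ≤ 1 → |m₀| ≤ 1 →
      ∀ (x₀ : TorusSite 4 L) (R ℓ : ℕ), C * (1 + Real.log (L : ℝ)) / t ≤ (ℓ : ℝ) →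
      ∀ (U₁ V₁ U₂ V₂ : GaugeConfig 4 L SU3),
        (∀ e : TorusSite 4 L × Fin 4, R < torusTaxiDist e.1 x₀ → V₁ e = U₁ e ∧ V₂ e = U₂ e) →
        (∀ e : TorusSite 4 L × Fin 4, torusTaxiDist e.1 x₀ ≤ R + ℓ → U₂ e = U₁ e ∧ V₂ e = V₁ e) →
        (∀ U ∈ [U₁, V₁, U₂, V₂], Multiset.countP (fun z : ℂ => |z.re| < t)
          (spinorLift gammaFive * wilsonDirac (fundamentalRep (Fin 3)) U m₀ 1).charpoly.roots = 0) →
        (Multiset.countP (fun z : ℂ => z.re < 0)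
            (spinorLift gammaFive * wilsonDirac (fundamentalRep (Fin 3)) V₁ m₀ 1).charpoly.roots : ℤ) -
          Multiset.countP (fun z : ℂ => z.re < 0)
            (spinorLift gammaFive * wilsonDirac (fundamentalRep (Fin 3)) U₁ m₀ 1).charpoly.roots =
        (Multiset.countP (fun z : ℂ => z.re < 0)
            (spinorLift gammaFive * wilsonDirac (fundamentalRep (Fin 3)) V₂ m₀ 1).charpoly.roots : ℤ) -
          Multiset.countP (fun z : ℂ => z.re < 0)
            (spinorLift gammaFive * wilsonDirac (fundamentalRep (Fin 3)) U₂ m₀ 1).charpoly.roots) →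
    ∀ (Nf : ℕ), Nf = 2 ∨ Nf = 3 → ∀ (reg : QCDRegularisation Nf) (M₀ c : ℝ), 0 ≤ M₀ → 0 < c →
      reg.HasMassScaling → (reg.scheme 0 0 0).HasAsymptoticScaling →
      (∃ p : ℕ, ∀ᶠ k in atTop, (reg.L k : ℝ) ≤ (reg.a k)⁻¹ ^ p) → (∀ᶠ k in atTop, -1 < reg.mcrit k) →
      (∀ m : Fin Nf → ℝ, (∀ f, M₀ < m f) →
        (∀ ε : ℝ, 0 < ε → ∀ᶠ k in atTop, ∀ S : ℕ, reg.L k ≤ S → qcdPhaseQuenchedExpect (reg.β k) (2 * S + 1) (fun f => reg.mcrit k + reg.a k * m f / reg.Zm k) (fun U => ∑ f : Fin Nf, ((Multiset.countP (fun z : ℂ => z.im = 0 ∧ z.re < -(reg.mcrit k + reg.a k * m f / reg.Zm k)) (wilsonDirac (fundamentalRep (Fin 3)) U 0 1).charpoly.roots : ℝ) + (Multiset.countP (fun z : ℂ => |z.re| < c * (reg.a k * m f / reg.Zm k)) (spinorLift gammaFive * wilsonDirac (fundamentalRep (Fin 3)) U (reg.mcrit k + reg.a k * m f / reg.Zm k)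 1).charpoly.roots : ℝ))) ≤ ε * ((2 * S + 1 : ℝ) / (2 * reg.L k + 1)) ^ 4) ∧
        (∃ η : ℝ, 0 < η ∧ ∀ M : ℝ, M₀ < M → ∀ᶠ k in atTop, max 1 (η * (reg.a k * (2 * reg.L k + 1 : ℝ)) ^ 2) ≤ qcdPhaseQuenchedExpect (reg.β k) (2 * reg.L k + 1) (fun f => reg.mcrit k + reg.a k * m f / reg.Zm k) (fun U => |(Multiset.countP (fun z : ℂ => z.re < 0) (spinorLift gammaFive * wilsonDirac (fundamentalRep (Fin 3)) U (reg.mcrit k - reg.a k * M / reg.Zm k) 1).charpoly.roots : ℝ) - 6 * (2 * reg.L k + 1 : ℝ) ^ 4|))) →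
      ∀ m : Fin Nf → ℝ, (∀ f, M₀ < m f) → ∀ (z shift : QCDField Nf → ℕ → ℝ) (φ : ℕ → ℕ), StrictMono φ →
        (∃ T : OSData (QCDField Nf) 4, (∀ (n : ℕ), n ≠ 0 → ∀ (σ : Fin n → QCDField Nf) (f : Fin n → 𝓢(EuclideanSpace ℝ (Fin 4), ℝ))
            (F : 𝓢((Fin n → EuclideanSpace ℝ (Fin 4)), ℂ)), IsTensorOf F (fun i => ofRealTest (f i)) → IsOffDiagonal F →
            Tendsto (fun k : ℕ => qcdPhaseQuenchedExpect ((reg.scheme m z shift).β (φ k))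
              ((reg.scheme m z shift).side (φ k)) (fun fl => (reg.scheme m z shift).mq fl (φ k))
              (fun U => fermiIntegral ((List.ofFn fun i => smearedInsertion (reg.scheme m z shift) (φ k) U (σ i) (f i)).prod *
                  fermiBoltzmann U fun fl => (reg.scheme m z shift).mq fl (φ k)) /
                fermiIntegral (fermiBoltzmann U fun fl => (reg.scheme m z shift).mq fl (φ k)))) atTop
              (𝓝 (T.schwinger n σ F)))) →
        ∀ (n : ℕ), n ≠ 0 → ∀ (σ : Fin n → QCDField Nf) (f : Fin n → 𝓢(EuclideanSpace ℝ (Fin 4), ℝ))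
          (F : 𝓢((Fin n → EuclideanSpace ℝ (Fin 4)), ℂ)), IsTensorOf F (fun i => ofRealTest (f i)) → IsOffDiagonal F →
          (∀ ε : ℝ, 0 < ε → ∀ᶠ k : ℕ in atTop,
            ‖(∫ U, fermiIntegral ((List.ofFn fun i => smearedInsertion (reg.scheme m z shift) (φ k) U (σ i) (f i)).prod *
                  fermiBoltzmann U fun fl => (reg.scheme m z shift).mq fl (φ k)) ∂(qcdGaugeMeasure (reg.scheme m z shift) (φ k))) -
                ∫ U, qcdDetPhase U (fun fl => (reg.scheme m z shift).mq fl (φ k)) *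
                  fermiIntegral ((List.ofFn fun i => smearedInsertion (reg.scheme m z shift) (φ k) U (σ i) (f i)).prod *
                    fermiBoltzmann U fun fl => (reg.scheme m z shift).mq fl (φ k)) ∂(qcdGaugeMeasure (reg.scheme m z shift) (φ k))‖ ≤
              ε * ∫ U, ‖(diracMatrix U fun fl => (reg.scheme m z shift).mq fl (φ k)).det‖
                ∂(qcdGaugeMeasure (reg.scheme m z shift) (φ k))) := by
  sorry

/-- **Stub C (`stub_pqCore`) — THE POSITIVE-WEIGHT CONTINUUM CORE at the scheme volume (DECLARED YANG–MILLS GRADE; open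
problem; = weyl-window Stub 4 under the SD⁺ prefix; the stub that spends TIGHT⁺).** For `N_f ∈ {2,3}` and an SD⁺ witness
`(reg, M₀, c)` read phase-quenched there is ONE strictly increasing `φ` such that for EVERY tuple `m > M₀` some species
renormalisations `(z, shift)` and OS data `T` have: the phase-quenched lattice Schwinger functions of `reg.scheme m z shift`
converge along `φ` to `T.schwinger` on off-diagonal tensor test functions, `T.IsNontrivial glue`, `T.IsNonGaussian glue`, every
`pseudoRe f g` (`f ≠ g`) non-trivial, and `T.HasMassGap Δ` for some `Δ > 0`. This is UV stability + tightness + OS reconstruction +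
transfer-matrix gap for the POSITIVE-weight `∏|det|`-reweighted Wilson theory along an asymptotically free trajectory — no theorem in
print in `d = 4` (Bałaban 1985–89: UV stability of pure YM in finite volume is the nearest input); promote dossiers c1
`promote-pqContinuum.md`, VERDICT-c3, weyl-window-dead §"What a line would need" (2). TIGHT⁺ ∧ CAP are consumed HERE
(extensive two-sided pin at the flavour mass ⇒ the witness's line is the chiral line, quarks LIGHT and non-decoupled — what
`IsNontrivial (pseudoRe f g)` needs; without them shallow / tip witnesses make the stub false, Disproof §§2,4,7). Honest defects
displayed: (α) E2 of `T` is inherited from the honest side (the `∏|det|` weight of split / odd flavours is not reflection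
positive) through S and G; (β) the `∀ m` hole (`∃ φ` before `∀ m`: constants locally uniform on compacts of `(M₀,∞)^{N_f}` +
Arzelà–Ascoli in the mass). This line does NOT touch this stub and says so (card O2). [Balaban1989LargeFieldII;
OsterwalderSeiler1978 §§2–4; Luscher1977; Seiler1982 Ch. 3; MontvayMunster1994 §5.1; JaffeWitten2000 §§5–6] -/
theorem stub_pqCore :
    ∀ (Nf : ℕ), Nf = 2 ∨ Nf = 3 → ∀ (reg : QCDRegularisation Nf) (M₀ c : ℝ), 0 ≤ M₀ → 0 < c →
      reg.HasMassScaling → (reg.scheme 0 0 0).HasAsymptoticScaling →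
      (∃ p : ℕ, ∀ᶠ k in atTop, (reg.L k : ℝ) ≤ (reg.a k)⁻¹ ^ p) → (∀ᶠ k in atTop, -1 < reg.mcrit k) →
      (∀ m : Fin Nf → ℝ, (∀ f, M₀ < m f) →
        (∀ ε : ℝ, 0 < ε → ∀ᶠ k in atTop, ∀ S : ℕ, reg.L k ≤ S → qcdPhaseQuenchedExpect (reg.β k) (2 * S + 1) (fun f => reg.mcrit k + reg.a k * m f / reg.Zm k) (fun U => ∑ f : Fin Nf, ((Multiset.countP (fun z : ℂ => z.im = 0 ∧ z.re < -(reg.mcrit k + reg.a k * m f / reg.Zm k)) (wilsonDirac (fundamentalRep (Fin 3)) U 0 1).charpoly.roots : ℝ) + (Multiset.countP (fun z : ℂ => |z.re| < c * (reg.a k * m f / reg.Zm k)) (spinorLift gammaFive * wilsonDirac (fundamentalRep (Fin 3)) U (reg.mcrit k + reg.a k * m f / reg.Zm k) 1).charpoly.roots : ℝ))) ≤ ε * ((2 * S + 1 : ℝ) / (2 * reg.L k + 1)) ^ 4) ∧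
        (∃ η : ℝ, 0 < η ∧ ∀ M : ℝ, M₀ < M → ∀ᶠ k in atTop, max 1 (η * (reg.a k * (2 * reg.L k + 1 : ℝ)) ^ 2) ≤ qcdPhaseQuenchedExpect (reg.β k) (2 * reg.L k + 1) (fun f => reg.mcrit k + reg.a k * m f / reg.Zm k) (fun U => |(Multiset.countP (fun z : ℂ => z.re < 0) (spinorLift gammaFive * wilsonDirac (fundamentalRep (Fin 3)) U (reg.mcrit k - reg.a k * M / reg.Zm k) 1).charpoly.roots : ℝ) - 6 * (2 * reg.L k + 1 : ℝ) ^ 4|))) →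
      ∃ φ : ℕ → ℕ, StrictMono φ ∧ ∀ m : Fin Nf → ℝ, (∀ f, M₀ < m f) →
        ∃ (z shift : QCDField Nf → ℕ → ℝ) (T : OSData (QCDField Nf) 4),
          (∀ (n : ℕ), n ≠ 0 → ∀ (σ : Fin n → QCDField Nf) (f : Fin n → 𝓢(EuclideanSpace ℝ (Fin 4), ℝ))
            (F : 𝓢((Fin n → EuclideanSpace ℝ (Fin 4)), ℂ)), IsTensorOf F (fun i => ofRealTest (f i)) → IsOffDiagonal F →
            Tendsto (fun k : ℕ => qcdPhaseQuenchedExpect ((reg.scheme m z shift).β (φ k))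
              ((reg.scheme m z shift).side (φ k)) (fun fl => (reg.scheme m z shift).mq fl (φ k))
              (fun U => fermiIntegral ((List.ofFn fun i => smearedInsertion (reg.scheme m z shift) (φ k) U (σ i) (f i)).prod *
                  fermiBoltzmann U fun fl => (reg.scheme m z shift).mq fl (φ k)) /
                fermiIntegral (fermiBoltzmann U fun fl => (reg.scheme m z shift).mq fl (φ k)))) atTop
              (𝓝 (T.schwinger n σ F))) ∧
          T.IsNontrivial QCDField.glue ∧ T.IsNonGaussian QCDField.glue ∧
          (∀ f g : Fin Nf, f ≠ g → T.IsNontrivial (QCDField.pseudoRe f g)) ∧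
          ∃ Δ > 0, T.HasMassGap Δ := by
  sorry

/-! ## §2 Composition helpers (sorry-free): subsequences, antitonicity, the phase-quenched reading -/

section Helpers

variable {Nf : ℕ}

/-- The subsequence `sch ∘ φ` of a scheme (all data precomposed with a strictly increasing `φ`). -/
def schemeSubseq (sch : QCDScheme Nf) (φ : ℕ → ℕ) (hφ : StrictMono φ) : QCDScheme Nf where
  a := fun k => sch.a (φ k)
  a_pos := fun k => sch.a_pos (φ k)
  tendsto_a := sch.tendsto_a.comp hφ.tendsto_atTop
  β := fun k => sch.β (φ k)
  L := fun k => sch.L (φ k)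
  tendsto_L := sch.tendsto_L.comp hφ.tendsto_atTop
  mq := fun f k => sch.mq f (φ k)
  z := fun s k => sch.z s (φ k)
  shift := fun s k => sch.shift s (φ k)

/-- The subsequence `reg ∘ φ` of a regularisation (`m_crit`, `Z_m` precomposed too). -/
def regSubseq (reg : QCDRegularisation Nf) (φ : ℕ → ℕ) (hφ : StrictMono φ) : QCDRegularisation Nf where
  a := fun k => reg.a (φ k)
  a_pos := fun k => reg.a_pos (φ k)
  tendsto_a := reg.tendsto_a.comp hφ.tendsto_atTop
  β := fun k => reg.β (φ k)
  L := fun k => reg.L (φ k)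
  tendsto_L := reg.tendsto_L.comp hφ.tendsto_atTop
  mcrit := fun k => reg.mcrit (φ k)
  Zm := fun k => reg.Zm (φ k)
  Zm_pos := fun k => reg.Zm_pos (φ k)

/-- **The scheme of the subsequence IS the subsequence of the scheme** (definitional, field by field). -/
theorem regSubseq_scheme (reg : QCDRegularisation Nf) (φ : ℕ → ℕ) (hφ : StrictMono φ)
    (m : Fin Nf → ℝ) (z shift : QCDField Nf → ℕ → ℝ) :
    (regSubseq reg φ hφ).scheme m (fun s k => z s (φ k)) (fun s k => shift s (φ k)) =
      schemeSubseq (reg.scheme m z shift) φ hφ := rfl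

/-- Lattice Schwinger functions reindex along subsequences (definitional). -/
theorem qcdLatticeSchwinger_subseq (sch : QCDScheme Nf) (φ : ℕ → ℕ) (hφ : StrictMono φ)
    (k n : ℕ) (σ : Fin n → QCDField Nf) (f : Fin n → 𝓢(EuclideanSpace ℝ (Fin 4), ℝ)) :
    qcdLatticeSchwinger (schemeSubseq sch φ hφ) k n σ f = qcdLatticeSchwinger sch (φ k) n σ f := rfl

/-- `HasLatticeMassGap` passes to subsequences. -/
theorem hasLatticeMassGap_subseq {sch : QCDScheme Nf} {Δ : ℝ} (h : sch.HasLatticeMassGap Δ)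
    (φ : ℕ → ℕ) (hφ : StrictMono φ) : (schemeSubseq sch φ hφ).HasLatticeMassGap Δ := by
  intro R R' A B
  obtain ⟨C, hC⟩ := h R R' A B
  exact ⟨C, hφ.tendsto_atTop.eventually hC⟩

/-- `HasAsymptoticScaling` passes to subsequences. -/
theorem hasAsymptoticScaling_subseq {sch : QCDScheme Nf} (h : sch.HasAsymptoticScaling)
    (φ : ℕ → ℕ) (hφ : StrictMono φ) : (schemeSubseq sch φ hφ).HasAsymptoticScaling := by
  obtain ⟨Λ, hΛ, h⟩ := h
  exact ⟨Λ, hΛ, h.comp hφ.tendsto_atTop⟩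

/-- `HasMassScaling` passes to subsequences. -/
theorem hasMassScaling_subseq {reg : QCDRegularisation Nf} (h : reg.HasMassScaling)
    (φ : ℕ → ℕ) (hφ : StrictMono φ) : (regSubseq reg φ hφ).HasMassScaling := by
  obtain ⟨c, hc, h⟩ := h
  exact ⟨c, hc, h.comp hφ.tendsto_atTop⟩

/-- The lattice gap predicate is antitone in `Δ` (`a_k > 0`, `n ≥ 0`). -/
theorem hasLatticeMassGap_anti {sch : QCDScheme Nf} {Δ Δ' : ℝ} (h : sch.HasLatticeMassGap Δ)
    (hle : Δ' ≤ Δ) : sch.HasLatticeMassGap Δ' := by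
  intro R R' A B
  obtain ⟨C, hC⟩ := h R R' A B
  refine ⟨max C 0, ?_⟩
  filter_upwards [hC] with k hk S hS n hn
  refine (hk S hS n hn).trans ?_
  have ha : 0 ≤ sch.a k * n := mul_nonneg (sch.a_pos k).le (Nat.cast_nonneg n)
  calc C * Real.exp (-(Δ * (sch.a k * n)))
      ≤ max C 0 * Real.exp (-(Δ * (sch.a k * n))) :=
        mul_le_mul_of_nonneg_right (le_max_left _ _) (Real.exp_pos _).le
    _ ≤ max C 0 * Real.exp (-(Δ' * (sch.a k * n))) :=
        mul_le_mul_of_nonneg_left (Real.exp_le_exp.2 (by nlinarith)) (le_max_right _ _)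

/-- The OS mass-gap predicate is antitone in `Δ` (`t ≥ 0`). -/
theorem hasMassGap_anti {ι : Type} {d : ℕ} [NeZero d] {T : OSData ι d} {Δ Δ' : ℝ}
    (h : T.HasMassGap Δ) (hle : Δ' ≤ Δ) : T.HasMassGap Δ' := by
  intro n m k k' F G hF hG
  obtain ⟨C, hC⟩ := h n m k k' F G hF hG
  refine ⟨max C 0, fun t ht H hH => (hC t ht H hH).trans ?_⟩
  calc C * Real.exp (-Δ * t)
      ≤ max C 0 * Real.exp (-Δ * t) :=
        mul_le_mul_of_nonneg_right (le_max_left _ _) (Real.exp_pos _).le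
    _ ≤ max C 0 * Real.exp (-Δ' * t) :=
        mul_le_mul_of_nonneg_left (Real.exp_le_exp.2 (by nlinarith)) (le_max_right _ _)

/-- **The phase-quenched READING of the two SD⁺ clauses** (the raw quotients of the route text ARE `qcdPhaseQuenchedExpect`,
tree `qcdPhaseQuenchedExpect_eq_div_prod`; verbatim block-away's `hypPQ_of_raw`). -/
theorem hypPQ_of_raw (reg : QCDRegularisation Nf) (M₀ c : ℝ) (m : Fin Nf → ℝ)
    (hE : (∀ ε : ℝ, 0 < ε → ∀ᶠ k : ℕ in Filter.atTop, ∀ S : ℕ, reg.L k ≤ S → (∫ U, ((∑ f : Fin Nf, ((Multiset.countP (fun z : ℂ => z.im = 0 ∧ z.re < -(reg.mcrit k + reg.a k * m f / reg.Zm k)) (wilsonDirac (fundamentalRep (Fin 3)) U 0 1).charpoly.roots : ℝ) + (Multiset.countP (fun z : ℂ => |z.re| < c * (reg.a k * m f / reg.Zm k)) (spinorLift gammaFive * wilsonDirac (fundamentalRep (Fin 3)) U (reg.mcrit k + reg.a k * m f / reg.Zm k) 1).charpoly.roots : ℝ)))) * ∏ f : Fin Nf, ‖fermionDet (wilsonDirac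 (fundamentalRep (Fin 3)) U (reg.mcrit k + reg.a k * m f / reg.Zm k) 1)‖ ∂(wilsonMeasure (d := 4) (L := 2 * S + 1) (fundamentalRep (Fin 3)) (reg.β k))) / (∫ U, ∏ f : Fin Nf, ‖fermionDet (wilsonDirac (fundamentalRep (Fin 3)) U (reg.mcrit k + reg.a k * m f / reg.Zm k) 1)‖ ∂(wilsonMeasure (d := 4) (L := 2 * S + 1) (fundamentalRep (Fin 3)) (reg.β k))) ≤ ε * ((2 * S + 1 : ℝ) / (2 * reg.L k + 1)) ^ 4))
    (hT : (∃ η : ℝ, 0 < η ∧ ∀ M : ℝ, M₀ < M → ∀ᶠ k : ℕ in Filter.atTop, max 1 (η * (reg.a k * (2 * reg.L k + 1 : ℝ)) ^ 2) ≤ (∫ U, (|(Multiset.countP (fun z : ℂ => z.re < 0) (spinorLift gammaFive * wilsonDirac (fundamentalRep (Fin 3)) U (reg.mcrit k - reg.a k * M / reg.Zm k) 1).charpoly.roots : ℝ) - 6 * (2 * reg.L k + 1 : ℝ) ^ 4|) * ∏ f : Fin Nf, ‖fermionDet (wilsonDirac (fundamentalRep (Fin 3)) U (reg.mcrit k + reg.a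 k * m f / reg.Zm k) 1)‖ ∂(wilsonMeasure (d := 4) (L := 2 * reg.L k + 1) (fundamentalRep (Fin 3)) (reg.β k))) / (∫ U, ∏ f : Fin Nf, ‖fermionDet (wilsonDirac (fundamentalRep (Fin 3)) U (reg.mcrit k + reg.a k * m f / reg.Zm k) 1)‖ ∂(wilsonMeasure (d := 4) (L := 2 * reg.L k + 1) (fundamentalRep (Fin 3)) (reg.β k))))) :
    (∀ ε : ℝ, 0 < ε → ∀ᶠ k in atTop, ∀ S : ℕ, reg.L k ≤ S → qcdPhaseQuenchedExpect (reg.β k) (2 * S + 1) (fun f => reg.mcrit k + reg.a k * m f / reg.Zm k) (fun U => ∑ f : Fin Nf, ((Multiset.countP (fun z : ℂ => z.im = 0 ∧ z.re < -(reg.mcrit k + reg.a k * m f / reg.Zm k)) (wilsonDirac (fundamentalRep (Fin 3)) U 0 1).charpoly.roots : ℝ) + (Multiset.countP (fun z : ℂ => |z.re| < c * (reg.a k * m f / reg.Zm k)) (spinorLift gammaFive * wilsonDirac (fundamentalRep (Fin 3)) U (reg.mcrit k + reg.a k * m f / reg.Zm k) 1).charpoly.roots : ℝ))) ≤ ε *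 ((2 * S + 1 : ℝ) / (2 * reg.L k + 1)) ^ 4) ∧
    (∃ η : ℝ, 0 < η ∧ ∀ M : ℝ, M₀ < M → ∀ᶠ k in atTop, max 1 (η * (reg.a k * (2 * reg.L k + 1 : ℝ)) ^ 2) ≤ qcdPhaseQuenchedExpect (reg.β k) (2 * reg.L k + 1) (fun f => reg.mcrit k + reg.a k * m f / reg.Zm k) (fun U => |(Multiset.countP (fun z : ℂ => z.re < 0) (spinorLift gammaFive * wilsonDirac (fundamentalRep (Fin 3)) U (reg.mcrit k - reg.a k * M / reg.Zm k) 1).charpoly.roots : ℝ) - 6 * (2 * reg.L k + 1 : ℝ) ^ 4|)) := by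
  refine ⟨fun ε hε => ?_, ?_⟩
  · filter_upwards [hE ε hε] with k hk S hS
    rw [qcdPhaseQuenchedExpect_eq_div_prod]
    exact hk S hS
  · obtain ⟨η, hη, h⟩ := hT
    refine ⟨η, hη, fun M hM => ?_⟩
    filter_upwards [h M hM] with k hk
    rw [qcdPhaseQuenchedExpect_eq_div_prod]
    exact hk

/-- TIGHT (raw quotient form, `Negative.Tight`) from the phase-quenched reading of TIGHT⁺ (`max 1 _ ≤ ⟨·⟩₊`): for the landed
mass pin `WeylWindow.stub_massPinAbsLeOne`. -/
theorem tight_of_tightPlusPQ (reg : QCDRegularisation Nf) (M₀ : ℝ) (m : Fin Nf → ℝ)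
    (hT : ∃ η : ℝ, 0 < η ∧ ∀ M : ℝ, M₀ < M → ∀ᶠ k in atTop, max 1 (η * (reg.a k * (2 * reg.L k + 1 : ℝ)) ^ 2) ≤ qcdPhaseQuenchedExpect (reg.β k) (2 * reg.L k + 1) (fun f => reg.mcrit k + reg.a k * m f / reg.Zm k) (fun U => |(Multiset.countP (fun z : ℂ => z.re < 0) (spinorLift gammaFive * wilsonDirac (fundamentalRep (Fin 3)) U (reg.mcrit k - reg.a k * M / reg.Zm k) 1).charpoly.roots : ℝ) - 6 * (2 * reg.L k + 1 : ℝ) ^ 4|)) :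
    Tight Nf reg M₀ m := by
  intro M hM
  obtain ⟨η, _hη, h⟩ := hT
  filter_upwards [h M hM] with k hk
  rw [qcdPhaseQuenchedExpect_eq_div_prod] at hk
  exact (le_max_left _ _).trans hk

end Helpers

/-! ## §3 The composition: the skeleton concludes the crux BY NAME -/

/-- **`ExtinctionBuildsQCD_of` — the crux from the registered stubs (kernel-checked; the stubs are used BY NAME, so this
theorem depends on their `sorry`s and on nothing else unproved).** Given `N_f ∈ {2,3}` and `SD⁺(N_f)`: P upgrades the witness to a
POLYGROWTH one `(reg, M₀, c)`; the two clauses are read phase-quenched (`hypPQ_of_raw`); C gives ONE subsequence `φ`; the THR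
witness is `reg' := reg ∘ φ` with `M₁ := M₀` (`HasMassScaling` passes to subsequences); for each `m > M₀` take `(z, shift, T, Δ_T)`
from C and `Δ_L` from G (fed the landed cocycle, R, and K = K_AG ∘ K_FM — K_FM fed R2 and A, K_AG fed the landed mass pin); `IsQCDAlong`: asymptotic scaling reindexes, the branch
clause is BRANCH + `a m/Z > 0`, and the honest `n`-point functions converge because the phase-quenched ones do and `honest − PQ →
0` (LANDED `signTransfer_of_signDefectRegularity`, fed EXTINCT and S); `Δ := min Δ_T Δ_L` by antitonicity. -/
theorem ExtinctionBuildsQCD_of : ExtinctionBuildsQCD := by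
  have hR := stub_rateDiverges
  have hR2 := stub_localRarityOfExtinct
  have hA := stub_conditionalSmallBall stub_tiltedCellAverage stub_localHaarWegnerWide
  have hFM := stub_kinematicBandScreening stub_leastSquaresCombesThomas stub_subharmonicDecay stub_smallBallLayerCake hR2 hA
  -- K = K_AG ∘ K_FM (v8), the mass pin from the landed `WeylWindow.stub_massPinAbsLeOne` (TIGHT ⇐ TIGHT⁺, phase-quenched reading undone)
  have hG := stub_signedLatticeGapKinematic stub_signCocycleLocal hR
    (fun Nf hNf reg M₀ c hM₀ hc hms has hcap hbr hpq hpoly m hm =>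
      stub_signScreeningOfBand Nf hNf reg c m hc (fun f => lt_of_le_of_lt hM₀ (hm f)) hms hbr
        (stub_massPinAbsLeOne Nf (by rcases hNf with rfl | rfl <;> norm_num) reg M₀ hM₀ hms hbr m hm
          (tight_of_tightPlusPQ reg M₀ m (hpq m hm).2))
        (hFM Nf hNf reg M₀ c hM₀ hc hms has hcap hbr hpq hpoly m hm))
  have hS := stub_signDefectRegularity stub_signCocycleLocal
  intro Nf hNf hSD
  obtain ⟨reg, M₀, c, hM₀, hc, hms, has, hcap, hbr, hbody, hpoly⟩ := stub_polyGrowthWitness Nf hNf hSD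
  -- phase-quenched reading of the two clauses, tuple by tuple
  have hpq := fun (m : Fin Nf → ℝ) (hm : ∀ f, M₀ < m f) =>
    hypPQ_of_raw reg M₀ c m (hbody m hm).1 (hbody m hm).2
  -- C: the positive-weight core along one φ
  obtain ⟨φ, hφ, hcore⟩ := stub_pqCore Nf hNf reg M₀ c hM₀ hc hms has hcap hbr hpq
  refine ⟨regSubseq reg φ hφ, hasMassScaling_subseq hms φ hφ, M₀, hM₀, fun m hm => ?_⟩
  have hm0 : ∀ f, 0 < m f := fun f => lt_of_le_of_lt hM₀ (hm f)
  have hE : Extinct Nf reg c m := (hbody m hm).1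
  obtain ⟨z, shift, T, hconv, hN, hNG, hP, Δ₁, hΔ₁, hgap₁⟩ := hcore m hm
  -- G: the signed lattice gap on all tori
  obtain ⟨Δ₂, hΔ₂, hgap₂⟩ := hG Nf hNf reg M₀ c hM₀ hc hms has hcap hbr hpq hpoly m hm
  -- S: sign-defect regularity along φ, then the landed scheme-volume transfer
  have hreg := hS Nf hNf reg M₀ c hM₀ hc hms has hcap hbr hpq m hm z shift φ hφ ⟨T, hconv⟩
  refine ⟨fun s k => z s (φ k), fun s k => shift s (φ k), T, ?_, hN, hNG, hP,
    min Δ₁ Δ₂, lt_min hΔ₁ hΔ₂, hasMassGap_anti hgap₁ (min_le_left _ _), ?_⟩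
  · -- `IsQCDAlong` along the subsequence
    rw [regSubseq_scheme]
    refine ⟨hasAsymptoticScaling_subseq has φ hφ, fun fl => ?_, ?_⟩
    · -- the physical-branch clause: BRANCH transported along `φ`, plus `a m/Z > 0`
      have hb := hφ.tendsto_atTop.eventually hbr
      filter_upwards [hb] with k hk
      show -1 < reg.mcrit (φ k) + reg.a (φ k) * m fl / reg.Zm (φ k)
      have hpos : 0 < reg.a (φ k) * m fl / reg.Zm (φ k) :=
        div_pos (mul_pos (reg.a_pos _) (hm0 fl)) (reg.Zm_pos _)
      linarith
    · intro n hn σ f F hF hoff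
      have hpqc := hconv n hn σ f F hF hoff
      have hd := signTransfer_of_signDefectRegularity reg z shift σ f hc hm0 hE hφ hpqc
        (hreg n hn σ f F hF hoff)
      have hsum := hpqc.add hd
      rw [add_zero] at hsum
      refine hsum.congr fun k => ?_
      rw [qcdLatticeSchwinger_subseq]
      ring
  · -- the lattice gap along the subsequence
    rw [regSubseq_scheme]
    exact hasLatticeMassGap_subseq (hasLatticeMassGap_anti (hgap₂ z shift) (min_le_right _ _)) φ hφ

end Summit.QuantumFields.QCD.Cruxes.ExtinctionBuildsQCD.DeterminantTilt

end
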